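import Literature.NumberTheory.Sieve.ParityWave0
import Literature.NumberTheory.Sieve.AsymptoticSieveForPrimes
import HarnessLib

/-!
# Friedlander–Iwaniec, *The polynomial `X² + Y⁴` captures its primes*: Theorem 1 down to its sieve-theoretic inputs

Trunk T-SIEVE, family `parity`. Source: J. Friedlander, H. Iwaniec, *The polynomial `X² + Y⁴`
captures its primes*, Ann. of Math. (2) 148 (1998), 945–1040 [FriedlanderIwaniecAnnals1998]
(= arXiv:math/9811185): §1 Theorem 1; §2 (2.1)–(2.17), Proposition 2.1; §3 `ρ`, (3.14)–(3.19),
Lemma 3.4, Proposition 3.5; §4 (4.1)–(4.8), Proposition 4.1.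

`Literature.NumberTheory.Sieve.ParityWave0` records Theorem 1, eq. (1.1), as the named fact
`Literature.NumberTheory.Sieve.friedlanderIwaniecSum_isEquivalent` (**parity.S17**):
`∑∑_{a, b ≥ 1, a² + b⁴ ≤ x} Λ(a² + b⁴) ∼ 4 π⁻¹ κ x^{3/4}`, `κ = ∫₀¹ (1 - t⁴)^{1/2} dt` (1.2)
(the printed (1.1) has the relative error `O(log log x / log x)`; the `~` form is its consequence).
This file formalises the COMPLETE printed architecture of the proof of Theorem 1, proving every
step that the paper proves in §§1–4 outside Propositions 2.1, 3.5, 4.1, and vendoring those three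
propositions, the evaluation (4.8) and the three hypotheses that §3 asserts without proof as named
facts:

  parity.S17 ⟸ (4.2) [PROVED] + (4.7)-with-(4.8)                      (Part I)
  (4.7)      ⟸ Prop. 2.1 + Prop. 3.5 + Prop. 4.1 + (4.8) + (2.2) + (2.7) + (2.8) [named facts],
               the glue ((2.1) from (4.2), (2.4)–(2.6) from (3.16), (2.9) from Prop. 3.5,
               (2.11) from Prop. 4.1, the parameter choices) being PROVED     (Part II)

so that `friedlanderIwaniecSum_isEquivalent_of_inputs` derives parity.S17 from exactly the seven
named facts `FriedlanderIwaniec1998_prop21`, `_prop35`, `_prop41`, `_densityConstant`, `_hyp22`,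
`_hyp27`, `_hyp28`.

# Part I. Theorem 1 from (4.2) and (4.7)–(4.8); proof of (4.2)

The printed proof runs (§4, after (4.8)): "Therefore (4.7), (4.8) and (4.2) yield the asymptotic
formula (1.1) of our main theorem. Note that in the formulation of Theorem 1 we restricted to
representations by positive integers thus obtaining a constant equal to one fourth of that in
(4.7)."  Here

* (4.1) `a_n` = the number of integral solutions `(a, c) ∈ ℤ²` of `a² + c⁴ = n`
  (`= ∑_{a² + b² = n} 𝔷(b)`, `𝔷(b) = #{c ∈ ℤ : c² = b}`, (3.1), (3.14));
* (4.2) = (3.18) (Lemma 3.4 with `d = 1`): `A(x) = ∑_{n ≤ x} a_n = 4 κ x^{3/4} + O(x^{1/2})`;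
* (4.7): `∑_{p ≤ x} a_p log p = H A(x) {1 + O(log log x / log x)}`, where by (4.8)
  `H = ∏_p (1 - χ₄(p) p⁻¹) = L(1, χ₄)⁻¹ = 4/π`.

## Contents of Part I

* `Literature.Parity.fiRepCount n = a_n` (4.1), `Literature.Parity.fiCount x = A(x)` (4.2),
  `Literature.Parity.fiPrimeSum x = ∑_{p ≤ x} a_p log p` (the left side of (4.7)); solutions of
  `a² + c⁴ = n` satisfy `|a|, |c| ≤ n`, so `a_n` is a `Finset.card` over the box `fiBox n = [-n, n]²`
  (`fiRepCount_eq_card`: any larger box gives the same count);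
* the named facts `Literature.NumberTheory.Sieve.FriedlanderIwaniec1998_count_asymp` ((4.2), elementary, PROVED:
  `Literature.NumberTheory.Sieve.FriedlanderIwaniec1998_count_asymp_holds`) and
  `Literature.NumberTheory.Sieve.FriedlanderIwaniec1998_primeSum_asymp` ((4.7) with (4.8), deep; assembled from its
  inputs in Part II);
* `Literature.Parity.friedlanderIwaniecKappa_pos : 0 < κ`;
* **`Literature.NumberTheory.Sieve.friedlanderIwaniecSum_isEquivalent_of_count_of_primeSum`** (PROVED):
  `FriedlanderIwaniec1998_count_asymp → FriedlanderIwaniec1998_primeSum_asymp →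
  friedlanderIwaniecSum_isEquivalent`, i.e. the last paragraph of the printed proof, including the
  two points it leaves to the reader: the prime powers `p^k`, `k ≥ 2` (present in `Λ` but not in
  `∑_p a_p log p`) and the solutions on the coordinate axes (present in `a_n` but not in the sum over
  positive `a, b`) contribute `O(x^{7/12} (log x)²) = o(x^{3/4})`;
* **`Literature.NumberTheory.Sieve.friedlanderIwaniecSum_isEquivalent_of_primeSum`** (PROVED):
  `FriedlanderIwaniec1998_primeSum_asymp → friedlanderIwaniecSum_isEquivalent`.

## The elementary error terms (namespace `Literature.Parity.FriedlanderIwaniecPrimes`)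

With `F(x) = friedlanderIwaniecSum x`, `S(x) = fiPrimeSum x`, for `x ∈ ℕ`:
`∑_{n ≤ x} a_n Λ(n) = ∑_{(a,c) ∈ ℤ², 1 ≤ a²+c⁴ ≤ x} Λ(a² + c⁴)` (fibrewise); the points with
`a c ≠ 0` give `4 F(x)` (sign symmetry), the axis points give `≤ 2 (2√x + 1) log x`; and
`∑_{n ≤ x} a_n Λ(n) - S(x) = ∑_{n = p^k ≤ x, k ≥ 2} a_n log p` is bounded using
(i) `a_n ≤ 2 (2 n^{1/4} + 1)` (for each `c` at most two `a`), which handles `k ≥ 3`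
(`≤ x^{1/3} (log₂ x + 1)` such `n`), and (ii) for `n = p²`:
`a_{p²} ≤ 2 #{(a, b) ∈ ℤ² : a² + b² = p²} ≤ 16 (#{(m, n) ∈ [-√X, √X]² : m² + n² = p} + 9)` for
`p ≤ X` via Mathlib's `PythagoreanTriple.classification` (every solution is
`k (m² - n², 2mn)` up to order with `k (m² + n²) = ±p`, so `|k| ∈ {1, p}`, `m² + n² ∈ {p, 1}`), and
the norm-`p` fibres are disjoint in `p`, so `∑_{p ≤ √x} a_{p²} ≤ 16 ((2 x^{1/4} + 1)² + 9 (√x + 1))`.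
Altogether `|4 F(x) - S(x)| ≤ 450 x^{7/12} (1 + log x)²` for `x ≥ 1`
(`abs_four_mul_sub_fiPrimeSum_le`), and Theorem 1 follows from (4.2), (4.7)–(4.8) by
`IsLittleO`/`IsEquivalent` algebra along `ℕ`.

## The lattice-point count (4.2) (proof of `FriedlanderIwaniec1998_count_asymp_holds`)

FI derive (4.2) = (3.18) from Lemma 3.4 (`d = 1`), whose proof opens with
`M_d(x) = (2/d) ∑_{|c| ≤ x^{1/4}} ρ(c²; d) {(x - c⁴)^{1/2} + O(1)}`. Here, with `N = ⌊x⌋`: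
`A(x) + 1 = #{(a, c) ∈ ℤ² : a² + c⁴ ≤ N} = ∑_c #{a : a² ≤ N - c⁴}` (`sum_fiRepCount_add_one`,
`card_fiDisc_eq_sum`), a slice with `c⁴ ≤ N` has `2⌊√(N - c⁴)⌋ + 1` points (`card_slice_eq`), which
is `2 g(c) + O(1)` with `g(t) = √(x - t⁴)` (`abs_card_slice_sub_le`; there are `≤ 2√N + 1` such `c`),
`g` is even and decreasing on `[0, ∞)` with `g(N + 1) = 0`, so
`∑_{1 ≤ c ≤ N} g(c) ≤ ∫₀^{N+1} g ≤ ∑_{1 ≤ c ≤ N} g(c) + √x` (`AntitoneOn.integral_le_sum`,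
`AntitoneOn.sum_le_integral`), and `∫₀^{L} g = κ x^{3/4}` for `L ≥ x^{1/4}` by `t = x^{1/4} u`
(`integral_fiSlice`). Altogether `|A(x) - 4 κ x^{3/4}| ≤ 14 √x` for `x ≥ 1` (`abs_fiCount_sub_le`).

# Part II. (4.7) from Propositions 2.1, 3.5, 4.1 and (4.8)

In print, (4.7) is Proposition 2.1 (the asymptotic sieve for primes of the companion paper
[FriedlanderIwaniecASP1998], restated in §2 "in a form which is suitable for the proof of the main
theorem": sequences supported on all integers, a cubefree level hypothesis (2.9), bilinear forms
(2.11) with a sieving parameter `P`) applied to `a_n` with: Proposition 3.5 (hypothesis (2.9) with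
`D = x^{3/4 - 5ε}`), Proposition 4.1 (hypothesis (2.11); §§4–26, "the heart of the problem"), the
easy hypotheses (2.1), (2.2), (2.4)–(2.8) (§3, after Prop. 3.5: from (3.16), the prime number
theorem modulo `4`, and "obvious" crude bounds), and the evaluation (4.8) `H = L(1, χ₄)⁻¹ = 4/π` of
the constant (2.17). Part II vendors the objects and the printed results over the tree's
`Literature.NumberTheory.Sieve.SieveSequence` (nothing of `LevelOfDistribution` / `AsymptoticSieveForPrimes` is redefined;
`SieveSequence.fiGamma` is FI's `γ(n, C)`, so `β(n, C) = μ(n) γ(n, C)` (2.12)) and proves the glue.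

## Contents of Part II

* `Literature.Parity.fiRho d = ρ(d) = #{α mod d : α² + 1 ≡ 0}` (§3), `Literature.Parity.fiDensity = g` of (3.16)
  (`ArithmeticFunction ℝ`, multiplicative: `isMultiplicative_fiDensity`; `fiDensity_prime`,
  `fiDensity_prime_sq`, `fiDensity_four`, `fiDensity_two = 1/2`, `fiDensity_five = 9/25`);
* `Literature.Parity.fiSieveSeq : SieveSequence` — `a = a_n` (4.1), `size = A(x)` (so that
  `remainder d t = r_d(t) = A_d(t) - g(d) A(t)`, (2.3)/(3.17): `fiSieveSeq_remainder`,
  `fiSieveSeq_size_eq`), `density = g`;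
* `Literature.NumberTheory.Sieve.IsCubefree` (decidable; `IsCubefree.of_squarefree`);
* `Literature.SieveSequence.fiBilinearPi A x N C P` — the bilinear form (2.11) = (4.3);
* `Literature.SieveSequence.FI1998SieveHypotheses A D δ Δ P` — the conjunction (2.1)–(2.15);
* named facts: `Literature.NumberTheory.Sieve.FriedlanderIwaniec1998_prop21` (Prop. 2.1 in its working regime
  `δ = (log x)^α`, `Δ = x^θ`), `Literature.NumberTheory.Sieve.FriedlanderIwaniec1998_prop35` (Prop. 3.5),
  `Literature.NumberTheory.Sieve.FriedlanderIwaniec1998_prop41` (Prop. 4.1),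
  `Literature.NumberTheory.Sieve.FriedlanderIwaniec1998_densityConstant` ((4.8): `fiSieveSeq.HasDensityConstant (4/π)`),
  and the three hypotheses of Prop. 2.1 for `a_n` that §3 asserts without proof:
  `Literature.NumberTheory.Sieve.FriedlanderIwaniec1998_hyp22` (2.2), `Literature.NumberTheory.Sieve.FriedlanderIwaniec1998_hyp27` (2.7),
  `Literature.NumberTheory.Sieve.FriedlanderIwaniec1998_hyp28` (2.8);
* PROVED: `fiRho_prime` (`ρ(p) = 1 + χ₄(p)` for odd primes, via `ZMod.exists_sq_eq_neg_one_iff`),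
  hypotheses (2.4)–(2.6) for `g` ("easily verified by an examination of (3.16)": `fiDensity_hyp24`,
  `fiDensity_hyp2526`), `one_sub_fiDensity_prime` (the factor of (4.8)), (2.1) from (4.2)
  (`hyp21_of_count`), the parameter ranges (`ranges_eventually`), (2.9) from Prop. 3.5
  (`hyp29_of_prop35`), (2.11) from Prop. 4.1 (`hyp211_of_prop41`), and the assembly
  **`FriedlanderIwaniec1998_primeSum_asymp_of_inputs`** and
  **`friedlanderIwaniecSum_isEquivalent_of_inputs`** (parameter choices: `ε = θ = 1/200`,
  `D = x^{3/4 - 5ε}`, `Δ = x^θ`, `P = exp((log log x)²)`, `η = 1/16` and `A = 2^{26} + 5` in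
  Prop. 4.1, then `δ = (log x)^B` with the `B` it provides).

## Faithfulness notes

* `g` is printed only on `p` and `p²` ((3.16), for the cubefree moduli of (3.19)); the extension to
  an `ArithmeticFunction` uses the junk value `g(p^k) = 0`, `k ≥ 3`, which no statement here reads.
* Prop. 2.1 is printed with free parameters `Δ ≥ δ ≥ 2` and the error `O(log δ / log Δ)`; read
  literally over all parameter functions that display is not a theorem (vacuous (2.14) with tiny
  `log δ / log Δ`; see `Literature.NumberTheory.Sieve.fi_asymptotic_sieve_primes` versus `Literature.NumberTheory.Sieve.fi_asymptotic_sieve_primes_loglog`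
  in `AsymptoticSieveForPrimes`), so it is vendored, like the companion Theorem 1, in the regime the
  source names ("In practice `δ` is a large power of `log x` and `Δ` is a small power of `x`") and
  uses in §4. The `P` of (2.15) "can be chosen at will": it is a parameter function of the
  hypotheses bundle, and (2.11) is demanded for that `P`.
* `Π`: §2 prints "the product of all primes `p < P`", §4 (4.3) prints "`p ≤ P`"; the coprimality
  `(n, Π) = 1` is rendered as "every prime factor of `n` is `≥ P`" (the §2 reading); `(n, m) = 1` is
  `Nat.Coprime`.
* Prop. 3.5 is stated for all sufficiently large `x`, every `D ≥ 1` and all real `t ≤ x`, the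
  constant depending on `ε` only (as in Lemma 3.1 from which it is derived); Prop. 4.1 with `∃ B, ∃ K, ∀ᶠ x` ("`B` and the implied constant
  need to be taken sufficiently large in terms of `η` and `A`"; `x` large), for every `P` in (4.4).
* (4.8) is the value of the ordered Euler product `∏_{p ≤ x} (1 - g(p))(1 - 1/p)⁻¹ → 4/π`
  (`SieveSequence.HasDensityConstant`), i.e. `∏_p (1 - χ₄(p)/p) = L(1, χ₄)⁻¹` (Mertens) and
  `L(1, χ₄) = π/4` (Leibniz; Mathlib `Real.tendsto_sum_pi_div_four` is the series, not the product).
* (2.2), (2.8) are printed as "obvious in our case" and (2.7) as "derived from the Prime Number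
  Theorem for the primes in residue classes modulo four" (§3); no proofs are printed, and they are
  vendored as named facts with that locator, in exactly the shape consumed by Prop. 2.1.

## Mathlib / tree search

Mathlib: `ArithmeticFunction.vonMangoldt` (`Λ`, `vonMangoldt_le_log`, `vonMangoldt_eq_zero_iff`,
`vonMangoldt_apply_prime`), `IsPrimePow.minFac_pow_factorization_eq`, `Nat.primesLE`, `Nat.sqrt`,
`Nat.log`, `PythagoreanTriple.classification`, `Asymptotics.IsEquivalent`, `IsLittleO`,
`isLittleO_log_rpow_rpow_atTop`, `Real.isLittleO_pow_log_id_atTop`, `tendsto_rpow_neg_atTop`,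
`intervalIntegral_pos_of_pos_on`, `AntitoneOn.integral_le_sum` / `AntitoneOn.sum_le_integral`,
`intervalIntegral.integral_comp_div`, `Real.nat_sqrt_le_real_sqrt`,
`Finset.sum_card_fiberwise_eq_card_filter`, `ZMod.χ₄`, `ZMod.exists_sq_eq_neg_one_iff`,
`Nat.factorization_mul_of_coprime`, `Finsupp.prod_add_index_of_disjoint`; nothing on `a² + c⁴`
(`rg "b \^ 4|Friedlander"`: only `ParityWave0`), no cubefree predicate, no asymptotic sieve.
Tree: `friedlanderIwaniecSum`, `friedlanderIwaniecKappa`, `friedlanderIwaniecSum_isEquivalent`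
(`ParityWave0`); `SieveSequence`, `congrSum`, `remainder` (`LevelOfDistribution`),
`SieveSequence.fiGamma`, `SieveSequence.HasDensityConstant` (`AsymptoticSieveForPrimes`,
`ParityBarrier`) are reused, not redefined; `FIAsymptoticSieveHypotheses` there is the companion
paper's Theorem 1 (squarefree support) and does not apply to `a_n`.

## References

* J. Friedlander, H. Iwaniec, *The polynomial `X² + Y⁴` captures its primes*, Ann. of Math. (2)
  148 (1998), no. 3, 945–1040, doi:10.2307/121034 [FriedlanderIwaniecAnnals1998]: Theorem 1
  ((1.1)–(1.2)); §2 (2.1)–(2.17), Proposition 2.1; §3 (3.1)–(3.2), (3.14), Lemma 3.4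
  ((3.15)–(3.16)), (3.17)–(3.19), Proposition 3.5 and the paragraph following it; §4 (4.1)–(4.8),
  Proposition 4.1.
* J. Friedlander, H. Iwaniec, *Asymptotic sieve for primes*, Ann. of Math. (2) 148 (1998),
  1041–1065 [FriedlanderIwaniecASP1998] (Proposition 2.1 of the above).
-/

noncomputable section

open Filter Asymptotics Finset
open scoped ArithmeticFunction.vonMangoldt ArithmeticFunction.Moebius Topology

namespace Literature.NumberTheory.Sieve

/-! # Part I. Theorem 1 from (4.2) and (4.7)–(4.8); proof of (4.2) -/

/-! ### The Friedlander–Iwaniec sequence `a_n` and its counting functions -/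

/-- The box `[-m, m]²` in `ℤ²`, large enough to contain every solution of `a² + c⁴ = n` for
`n ≤ m`. [folklore] -/
def fiBox (m : ℕ) : Finset (ℤ × ℤ) := Icc (-(m : ℤ)) m ×ˢ Icc (-(m : ℤ)) m

/-- `#[-m, m]² = (2m + 1)²`. [folklore] -/
theorem card_fiBox (m : ℕ) : #(fiBox m) = (2 * m + 1) ^ 2 := by
  have h : #(Icc (-(m : ℤ)) m) = 2 * m + 1 := by
    rw [Int.card_Icc]; omega
  rw [fiBox, card_product, h, sq]

/-- If `a² ≤ m` and `c² ≤ m` then `(a, c) ∈ [-m, m]²`. [folklore] -/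
theorem mem_fiBox_of_sq_le {a c : ℤ} {m : ℕ} (ha : a ^ 2 ≤ m) (hc : c ^ 2 ≤ m) :
    (a, c) ∈ fiBox m := by
  have ha' : |a| ≤ a ^ 2 := by rw [Int.abs_eq_natAbs]; exact Int.natAbs_le_self_sq a
  have hc' : |c| ≤ c ^ 2 := by rw [Int.abs_eq_natAbs]; exact Int.natAbs_le_self_sq c
  simp only [fiBox, mem_product, mem_Icc]
  refine ⟨⟨?_, ?_⟩, ?_, ?_⟩ <;>
    linarith [(abs_le.mp (ha'.trans ha)).1, (abs_le.mp (ha'.trans ha)).2,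
      (abs_le.mp (hc'.trans hc)).1, (abs_le.mp (hc'.trans hc)).2]

/-- FI (4.1): `a_n` = the number of integral solutions `(a, c) ∈ ℤ²` of `a² + c⁴ = n`
(= `∑_{a² + b² = n} 𝔷(b)` with `𝔷(b) = #{c ∈ ℤ : c² = b}`, FI (3.1), (3.14)).
[cite: FriedlanderIwaniecAnnals1998, (4.1)] -/
def fiRepCount (n : ℕ) : ℕ :=
  #{ac ∈ fiBox n | ac.1 ^ 2 + ac.2 ^ 4 = (n : ℤ)}

/-- FI (4.2): the counting function `A(x) = ∑_{n ≤ x} a_n`. [cite: FriedlanderIwaniecAnnals1998, (4.2)] -/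
def fiCount (x : ℝ) : ℝ := ∑ n ∈ Icc 1 ⌊x⌋₊, (fiRepCount n : ℝ)

/-- FI §2/(4.7): `S(x) = ∑_{p ≤ x} a_p log p`. [cite: FriedlanderIwaniecAnnals1998, §2 (S(x)) and (4.7)] -/
def fiPrimeSum (x : ℝ) : ℝ := ∑ p ∈ Nat.primesLE ⌊x⌋₊, (fiRepCount p : ℝ) * Real.log p

/-! ### Named facts (4.2) and (4.7)–(4.8) -/

/-- **FI (4.2) = (3.18)** (Lemma 3.4 with `d = 1`): `A(x) = ∑_{n ≤ x} a_n = 4 κ x^{3/4} + O(x^{1/2})`,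
`κ = ∫₀¹ (1 - t⁴)^{1/2} dt`. Elementary (lattice points under `a² + c⁴ ≤ x`).
[cite: FriedlanderIwaniecAnnals1998, (4.2) and (3.18)] -/
def FriedlanderIwaniec1998_count_asymp : Prop :=
  (fun x : ℝ => fiCount x - 4 * friedlanderIwaniecKappa * x ^ (3 / 4 : ℝ)) =O[atTop]
    fun x : ℝ => x ^ (1 / 2 : ℝ)

/-- **FI (4.7) with (4.8)**: `∑_{p ≤ x} a_p log p = H A(x) {1 + O(log log x / log x)}` with
`H = ∏_p (1 - χ₄(p) p⁻¹) = L(1, χ₄)⁻¹ = 4/π`. This is the deep input: Proposition 2.1 (the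
asymptotic sieve for primes of [FriedlanderIwaniecASP1998]) fed with Proposition 3.5 (level of
distribution `x^{3/4-ε}`, hypothesis (2.9)) and Proposition 4.1 (the bilinear form bound (2.11)),
§§4–26. [cite: FriedlanderIwaniecAnnals1998, (4.7)-(4.8) with Prop. 2.1, Prop. 3.5, Prop. 4.1] -/
def FriedlanderIwaniec1998_primeSum_asymp : Prop :=
  (fun x : ℝ => fiPrimeSum x - 4 / Real.pi * fiCount x) =O[atTop]
    fun x : ℝ => 4 / Real.pi * fiCount x * (Real.log (Real.log x) / Real.log x)

/-! ### Solutions live in a box -/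

/-- A solution of `a² + c⁴ = n` has `|a| ≤ n` and `|c| ≤ n`. [folklore] -/
theorem abs_le_of_sq_add_pow_four_eq {a c : ℤ} {n : ℕ} (h : a ^ 2 + c ^ 4 = (n : ℤ)) :
    |a| ≤ n ∧ |c| ≤ n := by
  have ha : |a| ≤ a ^ 2 := by
    rw [Int.abs_eq_natAbs]; exact Int.natAbs_le_self_sq a
  have hc : |c| ≤ c ^ 4 := by
    calc |c| ≤ c ^ 2 := by rw [Int.abs_eq_natAbs]; exact Int.natAbs_le_self_sq c
      _ ≤ (c ^ 2) ^ 2 := Int.le_self_sq _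
      _ = c ^ 4 := by ring
  constructor <;> nlinarith [sq_nonneg a, sq_nonneg (c ^ 2)]

/-- A solution of `a² + c⁴ = n` lies in every box `[-m, m]²`, `m ≥ n`. [folklore] -/
theorem mem_fiBox_of_eq {a c : ℤ} {n m : ℕ} (h : a ^ 2 + c ^ 4 = (n : ℤ)) (hnm : n ≤ m) :
    (a, c) ∈ fiBox m := by
  obtain ⟨ha, hc⟩ := abs_le_of_sq_add_pow_four_eq h
  have hm : (n : ℤ) ≤ m := by exact_mod_cast hnm
  simp only [fiBox, mem_product, mem_Icc]
  constructor <;> constructor <;> linarith [abs_le.mp ha, abs_le.mp hc, (abs_le.mp ha).1, (abs_le.mp hc).1]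

/-- The solution set of `a² + c⁴ = n` cut out of any box `[-m, m]²` with `m ≥ n` is the full
solution set. [folklore] -/
theorem filter_fiBox_eq {n m : ℕ} (hnm : n ≤ m) :
    {ac ∈ fiBox m | ac.1 ^ 2 + ac.2 ^ 4 = (n : ℤ)} =
      {ac ∈ fiBox n | ac.1 ^ 2 + ac.2 ^ 4 = (n : ℤ)} := by
  ext ⟨a, c⟩
  simp only [mem_filter]
  constructor
  · rintro ⟨-, h⟩; exact ⟨mem_fiBox_of_eq h le_rfl, h⟩
  · rintro ⟨-, h⟩; exact ⟨mem_fiBox_of_eq h hnm, h⟩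

/-- `a_n` computed in any box `[-m, m]²` with `m ≥ n`. [cite: FriedlanderIwaniecAnnals1998, (4.1)] -/
theorem fiRepCount_eq_card {n m : ℕ} (hnm : n ≤ m) :
    fiRepCount n = #{ac ∈ fiBox m | ac.1 ^ 2 + ac.2 ^ 4 = (n : ℤ)} := by
  rw [fiRepCount, filter_fiBox_eq hnm]

/-- `κ = ∫₀¹ (1 - t⁴)^{1/2} dt > 0`. [folklore] -/
theorem friedlanderIwaniecKappa_pos : 0 < friedlanderIwaniecKappa := by
  unfold friedlanderIwaniecKappa
  refine intervalIntegral.intervalIntegral_pos_of_pos_on ?_ ?_ zero_lt_one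
  · exact ((continuous_const.sub (continuous_pow 4)).sqrt).intervalIntegrable _ _
  · intro t ht
    apply Real.sqrt_pos.mpr
    have : t ^ 4 < 1 := pow_lt_one₀ ht.1.le ht.2 (by norm_num)
    linarith

/-! ### The elementary error terms -/

namespace FriedlanderIwaniecPrimes

/-! #### The lattice sum, fibrewise -/

/-- `q(a, c) = a² + c⁴ ∈ ℕ`. [folklore] -/
def fiQuartic (ac : ℤ × ℤ) : ℕ := (ac.1 ^ 2 + ac.2 ^ 4).toNat

/-- `(q(a, c) : ℤ) = a² + c⁴`. [folklore] -/
theorem fiQuartic_cast (ac : ℤ × ℤ) : (fiQuartic ac : ℤ) = ac.1 ^ 2 + ac.2 ^ 4 := by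
  rw [fiQuartic, Int.toNat_of_nonneg (by positivity)]

/-- `q(a, c) = n ↔ a² + c⁴ = n` in `ℤ`. [folklore] -/
theorem fiQuartic_eq_iff (ac : ℤ × ℤ) (n : ℕ) :
    fiQuartic ac = n ↔ ac.1 ^ 2 + ac.2 ^ 4 = (n : ℤ) := by
  rw [← fiQuartic_cast, Int.natCast_inj]

/-- `q(a, b) = a² + b⁴` for natural numbers `a, b`. [folklore] -/
@[simp] theorem fiQuartic_natCast (a b : ℕ) : fiQuartic ((a : ℤ), (b : ℤ)) = a ^ 2 + b ^ 4 := by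
  apply Int.natCast_inj.mp
  rw [fiQuartic_cast]; push_cast; ring

/-- The points of `[-x, x]²` with `1 ≤ a² + c⁴ ≤ x`. [folklore] -/
def fiPoints (x : ℕ) : Finset (ℤ × ℤ) := {ac ∈ fiBox x | fiQuartic ac ∈ Icc 1 x}

/-- Fibrewise: `∑_{n ≤ x} a_n Λ(n) = ∑_{(a, c) ∈ ℤ², 1 ≤ a² + c⁴ ≤ x} Λ(a² + c⁴)`. [folklore] -/
theorem sum_fiRepCount_mul_vonMangoldt (x : ℕ) :
    ∑ n ∈ Icc 1 x, (fiRepCount n : ℝ) * Λ n = ∑ ac ∈ fiPoints x, Λ (fiQuartic ac) := by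
  rw [← Finset.sum_fiberwise_of_maps_to (s := fiPoints x) (t := Icc 1 x) (g := fiQuartic)
    (fun ac hac => (mem_filter.mp hac).2)]
  refine Finset.sum_congr rfl fun n hn => ?_
  have hnx : n ≤ x := (mem_Icc.mp hn).2
  have hset : {ac ∈ fiPoints x | fiQuartic ac = n} =
      {ac ∈ fiBox x | ac.1 ^ 2 + ac.2 ^ 4 = (n : ℤ)} := by
    ext ac
    simp only [fiPoints, mem_filter, fiQuartic_eq_iff]
    constructor
    · rintro ⟨⟨h1, -⟩, h2⟩; exact ⟨h1, h2⟩
    · rintro ⟨h1, h2⟩; refine ⟨⟨h1, ?_⟩, h2⟩; rwa [(fiQuartic_eq_iff ac n).mpr h2]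
  rw [hset, Finset.sum_congr rfl (g := fun _ => (Λ n : ℝ)), Finset.sum_const, nsmul_eq_mul,
    fiRepCount_eq_card hnx]
  intro ac hac
  rw [(fiQuartic_eq_iff ac n).mpr (mem_filter.mp hac).2]

/-! #### Sign symmetry: the off-axis part is `4 F(x)` -/

/-- For an even function, `∑_{0 < |a| ≤ N} h(a) = 2 ∑_{1 ≤ a ≤ N} h(a)`. [folklore] -/
theorem sum_Icc_neg_filter_ne_zero {h : ℤ → ℝ} (heven : ∀ a, h (-a) = h a) (N : ℕ) :
    ∑ a ∈ (Icc (-(N : ℤ)) N).filter (· ≠ 0), h a = 2 * ∑ a ∈ Icc (1 : ℤ) N, h a := by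
  have hsplit : (Icc (-(N : ℤ)) N).filter (· ≠ 0) = Icc (1 : ℤ) N ∪ (Icc (1 : ℤ) N).image Neg.neg := by
    ext a
    simp only [mem_filter, mem_Icc, mem_union, mem_image]
    constructor
    · rintro ⟨⟨h1, h2⟩, h0⟩
      rcases lt_or_gt_of_ne h0 with h | h
      · right; exact ⟨-a, ⟨by omega, by omega⟩, by ring⟩
      · left; exact ⟨by omega, h2⟩
    · rintro (⟨h1, h2⟩ | ⟨b, ⟨hb1, hb2⟩, rfl⟩)
      · exact ⟨⟨by omega, h2⟩, by omega⟩
      · exact ⟨⟨by omega, by omega⟩, by omega⟩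
  have hdisj : Disjoint (Icc (1 : ℤ) N) ((Icc (1 : ℤ) N).image Neg.neg) := by
    rw [Finset.disjoint_left]
    rintro a ha hb
    simp only [mem_Icc, mem_image] at ha hb
    obtain ⟨b, hb, rfl⟩ := hb
    omega
  rw [hsplit, Finset.sum_union hdisj, Finset.sum_image (fun a _ b _ h => neg_inj.mp h)]
  simp only [heven]
  ring

/-- `∑_{a ∈ [1, N] ⊂ ℤ} h(a) = ∑_{a ∈ [1, N] ⊂ ℕ} h(a)`. [folklore] -/
theorem sum_Icc_int_eq_sum_Icc_nat (h : ℤ → ℝ) (N : ℕ) :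
    ∑ a ∈ Icc (1 : ℤ) N, h a = ∑ a ∈ Icc 1 N, h (a : ℤ) := by
  have : Icc (1 : ℤ) N = (Icc 1 N).image (fun a : ℕ => (a : ℤ)) := by
    ext a
    simp only [mem_Icc, mem_image]
    constructor
    · rintro ⟨h1, h2⟩
      refine ⟨a.toNat, ⟨by omega, by omega⟩, by omega⟩
    · rintro ⟨b, ⟨hb1, hb2⟩, rfl⟩; exact ⟨by omega, by omega⟩
  rw [this, Finset.sum_image (fun a _ b _ h => by exact_mod_cast h)]

/-- `q(-a, c) = q(a, c)`. [folklore] -/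
@[simp] theorem fiQuartic_neg_fst (a c : ℤ) : fiQuartic (-a, c) = fiQuartic (a, c) := by
  simp [fiQuartic, even_two.neg_pow]

/-- `q(a, -c) = q(a, c)`. [folklore] -/
@[simp] theorem fiQuartic_neg_snd (a c : ℤ) : fiQuartic (a, -c) = fiQuartic (a, c) := by
  have : (-c) ^ 4 = c ^ 4 := by ring
  simp [fiQuartic, this]

/-- The weight `Λ(a² + c⁴) · [a² + c⁴ ≤ x]`. [folklore] -/
def fiWeight (x : ℕ) (ac : ℤ × ℤ) : ℝ := if fiQuartic ac ≤ x then Λ (fiQuartic ac) else 0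

/-- The weight is even in `a`. [folklore] -/
theorem fiWeight_neg_fst (x : ℕ) (a c : ℤ) : fiWeight x (-a, c) = fiWeight x (a, c) := by
  simp [fiWeight]

/-- The weight is even in `c`. [folklore] -/
theorem fiWeight_neg_snd (x : ℕ) (a c : ℤ) : fiWeight x (a, -c) = fiWeight x (a, c) := by
  simp [fiWeight]

/-- The weight at a pair of natural numbers, in the form used by `friedlanderIwaniecSum`. [folklore] -/
theorem fiWeight_natCast (x a b : ℕ) :
    fiWeight x ((a : ℤ), (b : ℤ)) = if a ^ 2 + b ^ 4 ≤ x then (Λ (a ^ 2 + b ^ 4) : ℝ) else 0 := by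
  simp [fiWeight]

/-- The off-axis part of the lattice sum is `4` times the Friedlander–Iwaniec sum over positive
`a, b`. [folklore] -/
theorem sum_fiPoints_offAxis (x : ℕ) :
    ∑ ac ∈ (fiPoints x).filter (fun ac => ac.1 ≠ 0 ∧ ac.2 ≠ 0), Λ (fiQuartic ac) =
      4 * friedlanderIwaniecSum x := by
  have hset : (fiPoints x).filter (fun ac => ac.1 ≠ 0 ∧ ac.2 ≠ 0) =
      (((Icc (-(x : ℤ)) x).filter (· ≠ 0)) ×ˢ ((Icc (-(x : ℤ)) x).filter (· ≠ 0))).filter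
        (fun ac => fiQuartic ac ≤ x) := by
    ext ⟨a, c⟩
    simp only [fiPoints, fiBox, mem_filter, mem_product, mem_Icc]
    constructor
    · rintro ⟨⟨hb, -, h2⟩, ha, hc⟩; exact ⟨⟨⟨hb.1, ha⟩, hb.2, hc⟩, h2⟩
    · rintro ⟨⟨⟨hb1, ha⟩, hb2, hc⟩, h2⟩
      refine ⟨⟨⟨hb1, hb2⟩, ?_, h2⟩, ha, hc⟩
      have : (1 : ℤ) ≤ a ^ 2 + c ^ 4 := by nlinarith [sq_nonneg (c ^ 2), sq_pos_of_ne_zero ha]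
      have h' : ((1 : ℕ) : ℤ) ≤ (fiQuartic (a, c) : ℤ) := by
        rw [fiQuartic_cast]; exact_mod_cast this
      exact_mod_cast h'
  rw [hset, Finset.sum_filter, Finset.sum_product]
  change ∑ a ∈ (Icc (-(x : ℤ)) x).filter (· ≠ 0), ∑ c ∈ (Icc (-(x : ℤ)) x).filter (· ≠ 0),
    fiWeight x (a, c) = 4 * friedlanderIwaniecSum x
  have hinner : ∀ a : ℤ, ∑ c ∈ (Icc (-(x : ℤ)) x).filter (· ≠ 0), fiWeight x (a, c) =
      2 * ∑ c ∈ Icc 1 x, fiWeight x (a, (c : ℤ)) := fun a => by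
    rw [sum_Icc_neg_filter_ne_zero (h := fun c => fiWeight x (a, c)) (fun c => fiWeight_neg_snd x a c),
      sum_Icc_int_eq_sum_Icc_nat]
  simp_rw [hinner]
  rw [sum_Icc_neg_filter_ne_zero (h := fun a => 2 * ∑ c ∈ Icc 1 x, fiWeight x (a, (c : ℤ)))
    (fun a => by simp_rw [fiWeight_neg_fst]), sum_Icc_int_eq_sum_Icc_nat]
  simp_rw [fiWeight_natCast]
  rw [friedlanderIwaniecSum, show (4 : ℝ) = 2 * 2 by norm_num]
  simp only [Finset.mul_sum, mul_assoc]

/-! #### The axis part -/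

/-- If `c² ≤ x` then `c ∈ [-√x, √x]`. [folklore] -/
theorem mem_Icc_sqrt_of_sq_le {c : ℤ} {x : ℕ} (h : c ^ 2 ≤ (x : ℤ)) :
    c ∈ Icc (-(Nat.sqrt x : ℤ)) (Nat.sqrt x) := by
  have h1 : c.natAbs ^ 2 ≤ x := by
    have : ((c.natAbs ^ 2 : ℕ) : ℤ) ≤ x := by rwa [Nat.cast_pow, Int.natAbs_sq]
    exact_mod_cast this
  have h2 : c.natAbs ≤ Nat.sqrt x := Nat.le_sqrt'.mpr h1
  have h3 : (c.natAbs : ℤ) ≤ Nat.sqrt x := by exact_mod_cast h2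
  rw [mem_Icc]
  constructor <;> omega

/-- On `fiPoints x` the weight is at most `log x`. [folklore] -/
theorem vonMangoldt_fiQuartic_le_log {x : ℕ} {ac : ℤ × ℤ} (h : ac ∈ fiPoints x) :
    (Λ (fiQuartic ac) : ℝ) ≤ Real.log x := by
  have h' := mem_Icc.mp (mem_filter.mp h).2
  calc (Λ (fiQuartic ac) : ℝ) ≤ Real.log (fiQuartic ac) := ArithmeticFunction.vonMangoldt_le_log
    _ ≤ Real.log x := Real.log_le_log (by exact_mod_cast h'.1) (by exact_mod_cast h'.2)

/-- The axis points of `fiPoints x` lie in `{0} × [-√x, √x] ∪ [-√x, √x] × {0}`. [folklore] -/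
theorem filter_fiPoints_axis_subset (x : ℕ) :
    (fiPoints x).filter (fun ac => ¬(ac.1 ≠ 0 ∧ ac.2 ≠ 0)) ⊆
      ({(0 : ℤ)} ×ˢ Icc (-(Nat.sqrt x : ℤ)) (Nat.sqrt x)) ∪
        (Icc (-(Nat.sqrt x : ℤ)) (Nat.sqrt x) ×ˢ {(0 : ℤ)}) := by
  rintro ⟨a, c⟩ hac
  simp only [mem_filter, fiPoints, mem_Icc] at hac
  obtain ⟨⟨-, -, hle⟩, h0⟩ := hac
  have hle' : a ^ 2 + c ^ 4 ≤ (x : ℤ) := by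
    have := fiQuartic_cast (a, c)
    simp only at this
    rw [← this]; exact_mod_cast hle
  simp only [mem_union, mem_product, mem_singleton]
  by_cases ha : a = 0
  · left
    refine ⟨ha, mem_Icc_sqrt_of_sq_le ?_⟩
    calc c ^ 2 ≤ (c ^ 2) ^ 2 := Int.le_self_sq _
      _ = c ^ 4 := by ring
      _ ≤ x := by nlinarith [sq_nonneg a]
  · right
    have hc : c = 0 := by tauto
    refine ⟨mem_Icc_sqrt_of_sq_le ?_, hc⟩
    nlinarith [sq_nonneg (c ^ 2)]

/-- The axis part of the lattice sum is `≤ 2 (2√x + 1) log x`. [folklore] -/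
theorem sum_fiPoints_axis_le (x : ℕ) :
    ∑ ac ∈ (fiPoints x).filter (fun ac => ¬(ac.1 ≠ 0 ∧ ac.2 ≠ 0)), (Λ (fiQuartic ac) : ℝ) ≤
      2 * (2 * Nat.sqrt x + 1) * Real.log x := by
  have hcard : #((fiPoints x).filter (fun ac => ¬(ac.1 ≠ 0 ∧ ac.2 ≠ 0))) ≤ 2 * (2 * Nat.sqrt x + 1) := by
    refine (card_le_card (filter_fiPoints_axis_subset x)).trans ?_
    refine (card_union_le _ _).trans ?_
    have h : #(Icc (-(Nat.sqrt x : ℤ)) (Nat.sqrt x)) = 2 * Nat.sqrt x + 1 := by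
      rw [Int.card_Icc]; omega
    rw [card_product, card_product, card_singleton, h]
    omega
  have hlog : 0 ≤ Real.log x := Real.log_natCast_nonneg x
  calc ∑ ac ∈ (fiPoints x).filter (fun ac => ¬(ac.1 ≠ 0 ∧ ac.2 ≠ 0)), (Λ (fiQuartic ac) : ℝ)
      ≤ #((fiPoints x).filter (fun ac => ¬(ac.1 ≠ 0 ∧ ac.2 ≠ 0))) • Real.log x :=
        Finset.sum_le_card_nsmul _ _ _ fun ac hac => vonMangoldt_fiQuartic_le_log (mem_filter.mp hac).1
    _ ≤ (2 * (2 * Nat.sqrt x + 1) : ℕ) • Real.log x := nsmul_le_nsmul_left hlog hcard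
    _ = 2 * (2 * Nat.sqrt x + 1) * Real.log x := by rw [nsmul_eq_mul]; push_cast; ring

/-! #### Primes versus prime powers -/

/-- The primes in `[1, x]` are `Nat.primesLE x`. [folklore] -/
theorem filter_prime_Icc_eq_primesLE (x : ℕ) : (Icc 1 x).filter Nat.Prime = Nat.primesLE x := by
  ext p
  simp only [mem_filter, mem_Icc, Nat.mem_primesLE]
  constructor
  · rintro ⟨⟨-, h2⟩, hp⟩; exact ⟨h2, hp⟩
  · rintro ⟨h2, hp⟩; exact ⟨⟨hp.one_le, h2⟩, hp⟩

/-- `∑_{n ≤ x} a_n Λ(n) = ∑_{p ≤ x} a_p log p + ∑_{n ≤ x, n not prime} a_n Λ(n)`. [folklore] -/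
theorem sum_fiRepCount_mul_vonMangoldt_eq_add (x : ℕ) :
    ∑ n ∈ Icc 1 x, (fiRepCount n : ℝ) * Λ n =
      fiPrimeSum x + ∑ n ∈ (Icc 1 x).filter (fun n => ¬n.Prime), (fiRepCount n : ℝ) * Λ n := by
  rw [← Finset.sum_filter_add_sum_filter_not (Icc 1 x) Nat.Prime, filter_prime_Icc_eq_primesLE,
    fiPrimeSum, Nat.floor_natCast]
  congr 1
  refine Finset.sum_congr rfl fun p hp => ?_
  rw [ArithmeticFunction.vonMangoldt_apply_prime (Nat.mem_primesLE.mp hp).2]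

/-! #### A two-to-one counting lemma and the trivial bound `a_n ≤ 2 (2 n^{1/4} + 1)` -/

/-- If `f p = f q` on `S` forces `p = q` or `p = φ q`, then `#S ≤ 2 #f(S)`. [folklore] -/
theorem card_le_two_mul_card_image {α β : Type*} [DecidableEq α] [DecidableEq β] (S : Finset α)
    (f : α → β) (φ : α → α) (h : ∀ p ∈ S, ∀ q ∈ S, f p = f q → p = q ∨ p = φ q) :
    #S ≤ 2 * #(S.image f) := by
  refine Finset.card_le_mul_card_image S 2 fun b hb => ?_
  obtain ⟨q, hq, rfl⟩ := mem_image.mp hb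
  calc #(S.filter fun p => f p = f q) ≤ #({q, φ q} : Finset α) := by
        refine card_le_card fun p hp => ?_
        obtain ⟨hpS, hpq⟩ := mem_filter.mp hp
        rcases h p hpS q hq hpq with rfl | rfl <;> simp
    _ ≤ 2 := Finset.card_le_two

/-- If `c⁴ ≤ n` then `c ∈ [-n^{1/4}, n^{1/4}]` (integer fourth root `√√n`). [folklore] -/
theorem mem_Icc_sqrt_sqrt_of_pow_four_le {c : ℤ} {n : ℕ} (h : c ^ 4 ≤ (n : ℤ)) :
    c ∈ Icc (-(Nat.sqrt (Nat.sqrt n) : ℤ)) (Nat.sqrt (Nat.sqrt n)) := by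
  have h1 : c.natAbs ^ 4 ≤ n := by
    have e : (c.natAbs : ℤ) ^ 4 = c ^ 4 := by
      have h2 := Int.natAbs_sq c
      calc (c.natAbs : ℤ) ^ 4 = ((c.natAbs : ℤ) ^ 2) ^ 2 := by ring
        _ = (c ^ 2) ^ 2 := by rw [h2]
        _ = c ^ 4 := by ring
    have : ((c.natAbs ^ 4 : ℕ) : ℤ) ≤ n := by rw [Nat.cast_pow, e]; exact h
    exact_mod_cast this
  have h2 : c.natAbs ^ 2 ≤ Nat.sqrt n := by
    refine Nat.le_sqrt'.mpr ?_
    calc (c.natAbs ^ 2) ^ 2 = c.natAbs ^ 4 := by ring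
      _ ≤ n := h1
  have h3 : c.natAbs ≤ Nat.sqrt (Nat.sqrt n) := Nat.le_sqrt'.mpr h2
  have h4 : (c.natAbs : ℤ) ≤ Nat.sqrt (Nat.sqrt n) := by exact_mod_cast h3
  rw [mem_Icc]
  constructor <;> omega

/-- The trivial bound `a_n ≤ 2 (2 n^{1/4} + 1)`: for each `c` there are at most two `a`.
[folklore] -/
theorem fiRepCount_le (n : ℕ) : fiRepCount n ≤ 2 * (2 * Nat.sqrt (Nat.sqrt n) + 1) := by
  set S : Finset (ℤ × ℤ) := {ac ∈ fiBox n | ac.1 ^ 2 + ac.2 ^ 4 = (n : ℤ)} with hS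
  have h1 : #S ≤ 2 * #(S.image Prod.snd) := by
    refine card_le_two_mul_card_image S Prod.snd (fun ac => (-ac.1, ac.2)) ?_
    rintro ⟨a₁, c₁⟩ hp ⟨a₂, c₂⟩ hq (hc : c₁ = c₂)
    subst hc
    have e₁ := (mem_filter.mp hp).2
    have e₂ := (mem_filter.mp hq).2
    simp only at e₁ e₂
    have : a₁ ^ 2 = a₂ ^ 2 := by linarith
    rcases sq_eq_sq_iff_eq_or_eq_neg.mp this with h | h
    · left; simp [h]
    · right; simp [h]
  have h2 : S.image Prod.snd ⊆ Icc (-(Nat.sqrt (Nat.sqrt n) : ℤ)) (Nat.sqrt (Nat.sqrt n)) := by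
    intro c hc
    obtain ⟨⟨a, c'⟩, hac, rfl⟩ := mem_image.mp hc
    have e := (mem_filter.mp hac).2
    simp only at e
    exact mem_Icc_sqrt_sqrt_of_pow_four_le (by nlinarith [sq_nonneg a])
  have h3 : #(S.image Prod.snd) ≤ 2 * Nat.sqrt (Nat.sqrt n) + 1 := by
    refine (card_le_card h2).trans ?_
    rw [Int.card_Icc]; omega
  calc fiRepCount n = #S := rfl
    _ ≤ 2 * #(S.image Prod.snd) := h1
    _ ≤ 2 * (2 * Nat.sqrt (Nat.sqrt n) + 1) := by omega

/-! #### `a_{p²}` via Pythagorean triples -/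

/-- The integral solutions of `a² + b² = p²` (they lie in the box `[-p², p²]²`). [folklore] -/
def pythSol (p : ℕ) : Finset (ℤ × ℤ) := {ab ∈ fiBox (p ^ 2) | ab.1 ^ 2 + ab.2 ^ 2 = (p : ℤ) ^ 2}

/-- `a_{p²} ≤ 2 · #{(a, b) : a² + b² = p²}` (the map `(a, c) ↦ (a, c²)` is at most two-to-one).
[folklore] -/
theorem fiRepCount_sq_le (p : ℕ) : fiRepCount (p ^ 2) ≤ 2 * #(pythSol p) := by
  set S : Finset (ℤ × ℤ) := {ac ∈ fiBox (p ^ 2) | ac.1 ^ 2 + ac.2 ^ 4 = ((p ^ 2 : ℕ) : ℤ)} with hS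
  have h1 : #S ≤ 2 * #(S.image fun ac => (ac.1, ac.2 ^ 2)) := by
    refine card_le_two_mul_card_image S _ (fun ac => (ac.1, -ac.2)) ?_
    rintro ⟨a₁, c₁⟩ _ ⟨a₂, c₂⟩ _ h
    simp only [Prod.mk.injEq] at h
    obtain ⟨rfl, hc⟩ := h
    rcases sq_eq_sq_iff_eq_or_eq_neg.mp hc with h | h
    · left; simp [h]
    · right; simp [h]
  have h2 : (S.image fun ac => (ac.1, ac.2 ^ 2)) ⊆ pythSol p := by
    intro ab hab
    obtain ⟨⟨a, c⟩, hac, rfl⟩ := mem_image.mp hab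
    have e := (mem_filter.mp hac).2
    simp only [Nat.cast_pow] at e
    simp only [pythSol]
    refine mem_filter.mpr ⟨mem_fiBox_of_sq_le ?_ ?_, ?_⟩
    · push_cast; nlinarith [sq_nonneg (c ^ 2)]
    · push_cast; nlinarith [sq_nonneg a]
    · simp only; nlinarith
  calc fiRepCount (p ^ 2) = #S := rfl
    _ ≤ 2 * #(S.image fun ac => (ac.1, ac.2 ^ 2)) := h1
    _ ≤ 2 * #(pythSol p) := by gcongr

/-- The scalings `k ∈ {±1, ±p}` occurring in the parametrisation of `a² + b² = p²`. [folklore] -/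
def pythK (p : ℕ) : Finset ℤ := {1, -1, (p : ℤ), -(p : ℤ)}

/-- `#{±1, ±p} ≤ 4`. [folklore] -/
theorem card_pythK_le (p : ℕ) : #(pythK p) ≤ 4 := by
  unfold pythK
  refine (card_insert_le _ _).trans ?_
  refine (Nat.succ_le_succ (card_insert_le _ _)).trans ?_
  refine (Nat.succ_le_succ (Nat.succ_le_succ (card_insert_le _ _))).trans ?_
  simp

/-- The lattice points of norm `p` in the box `[-√X, √X]²` (fiber of `m² + n²` over `p`). [folklore] -/
def normFiber (X p : ℕ) : Finset (ℤ × ℤ) :=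
  {mn ∈ fiBox (Nat.sqrt X) | (mn.1 ^ 2 + mn.2 ^ 2).toNat = p}

/-- The parameters `(m, n)`: norm `p` (in the box `[-√X, √X]²`) or norm `1`. [folklore] -/
def pythM (X p : ℕ) : Finset (ℤ × ℤ) := normFiber X p ∪ normFiber 1 1

/-- The parametrisation map of `PythagoreanTriple.classification`. [folklore] -/
def pythF (t : ℤ × Bool × (ℤ × ℤ)) : ℤ × ℤ :=
  if t.2.1 then (t.1 * (t.2.2.1 ^ 2 - t.2.2.2 ^ 2), t.1 * (2 * t.2.2.1 * t.2.2.2))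
  else (t.1 * (2 * t.2.2.1 * t.2.2.2), t.1 * (t.2.2.1 ^ 2 - t.2.2.2 ^ 2))

/-- For `t ≥ 0`, `t.toNat = p ↔ t = p`. [folklore] -/
theorem toNat_eq_iff_of_nonneg {t : ℤ} (ht : 0 ≤ t) (p : ℕ) : t.toNat = p ↔ t = (p : ℤ) := by
  constructor
  · intro h; rw [← h, Int.toNat_of_nonneg ht]
  · intro h; rw [h, Int.toNat_natCast]

/-- Every solution of `a² + b² = p²`, `p` prime, is `pythF (k, s, (m, n))` with `k ∈ {±1, ±p}` and
`m² + n² ∈ {p, 1}`. [folklore] -/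
theorem pythSol_subset_image {p X : ℕ} (hp : p.Prime) (hpX : p ≤ X) :
    pythSol p ⊆ (pythK p ×ˢ (univ : Finset Bool) ×ˢ pythM X p).image pythF := by
  rintro ⟨a, b⟩ hab
  have e : a ^ 2 + b ^ 2 = (p : ℤ) ^ 2 := (mem_filter.mp hab).2
  have htr : PythagoreanTriple a b p := by unfold PythagoreanTriple; linear_combination e
  obtain ⟨k, m, n, hxy, hz⟩ := PythagoreanTriple.classification.mp htr
  have ht0 : 0 ≤ m ^ 2 + n ^ 2 := by positivity
  have hp0 : (0 : ℤ) < p := by exact_mod_cast hp.pos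
  have hk : (p : ℤ) = |k| * (m ^ 2 + n ^ 2) := by
    rcases hz with hz | hz
    · have : 0 ≤ k := by
        by_contra hk; push Not at hk; nlinarith
      rwa [abs_of_nonneg this]
    · have : k ≤ 0 := by
        by_contra hk; push Not at hk; nlinarith
      rw [abs_of_nonpos this]; linear_combination hz
  -- `m² + n² ∈ {1, p}`
  have hdvd : (m ^ 2 + n ^ 2).toNat ∣ p := by
    have : ((m ^ 2 + n ^ 2).toNat : ℤ) ∣ (p : ℤ) := by
      rw [Int.toNat_of_nonneg ht0]; exact ⟨|k|, by rw [hk]; ring⟩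
    exact Int.natCast_dvd_natCast.mp this
  have ht : m ^ 2 + n ^ 2 = 1 ∨ m ^ 2 + n ^ 2 = (p : ℤ) := by
    rcases hp.eq_one_or_self_of_dvd _ hdvd with h | h
    · left; exact_mod_cast (toNat_eq_iff_of_nonneg ht0 1).mp h
    · right; exact (toNat_eq_iff_of_nonneg ht0 p).mp h
  -- the parameters lie in the finite sets
  have hmem : k ∈ pythK p ∧ (m, n) ∈ pythM X p := by
    rcases ht with ht | ht
    · have hk' : |k| = p := by rw [ht, mul_one] at hk; exact hk.symm
      refine ⟨?_, ?_⟩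
      · simp only [pythK, mem_insert, mem_singleton]
        rcases (abs_eq hp0.le).mp hk' with h | h <;> simp [h]
      · refine mem_union_right _ (mem_filter.mpr ⟨?_, by rw [ht]; rfl⟩)
        exact mem_product.mpr ⟨mem_Icc_sqrt_of_sq_le (by push_cast; nlinarith [sq_nonneg n]),
          mem_Icc_sqrt_of_sq_le (by push_cast; nlinarith [sq_nonneg m])⟩
    · have hk' : |k| = 1 := by
        rw [ht] at hk
        have : (p : ℤ) * (|k| - 1) = 0 := by linear_combination -hk
        rcases mul_eq_zero.mp this with h | h
        · exact absurd h hp0.ne'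
        · linarith
      refine ⟨?_, ?_⟩
      · simp only [pythK, mem_insert, mem_singleton]
        rcases (abs_eq zero_le_one).mp hk' with h | h <;> simp [h]
      · refine mem_union_left _ (mem_filter.mpr ⟨?_, (toNat_eq_iff_of_nonneg ht0 p).mpr ht⟩)
        have hX : (p : ℤ) ≤ X := by exact_mod_cast hpX
        exact mem_product.mpr ⟨mem_Icc_sqrt_of_sq_le (by nlinarith [sq_nonneg n]),
          mem_Icc_sqrt_of_sq_le (by nlinarith [sq_nonneg m])⟩
  rcases hxy with ⟨ha, hb⟩ | ⟨ha, hb⟩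
  · refine mem_image.mpr ⟨(k, true, (m, n)), ?_, ?_⟩
    · exact mem_product.mpr ⟨hmem.1, mem_product.mpr ⟨mem_univ _, hmem.2⟩⟩
    · simp [pythF, ha, hb]
  · refine mem_image.mpr ⟨(k, false, (m, n)), ?_, ?_⟩
    · exact mem_product.mpr ⟨hmem.1, mem_product.mpr ⟨mem_univ _, hmem.2⟩⟩
    · simp [pythF, ha, hb]

/-- The norm-`1` fibre in `[-1, 1]²` has at most `9` points (crudely). [folklore] -/
theorem card_normFiber_one_le : #(normFiber 1 1) ≤ 9 := by
  refine (card_filter_le _ _).trans ?_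
  rw [card_fiBox, Nat.sqrt_one]; norm_num

/-- `#{(a, b) : a² + b² = p²} ≤ 8 (#{(m, n) ∈ [-√X, √X]² : m² + n² = p} + 9)` for `p ≤ X` prime.
[folklore] -/
theorem card_pythSol_le {p X : ℕ} (hp : p.Prime) (hpX : p ≤ X) :
    #(pythSol p) ≤ 8 * (#(normFiber X p) + 9) := by
  calc #(pythSol p) ≤ #((pythK p ×ˢ (univ : Finset Bool) ×ˢ pythM X p).image pythF) :=
        card_le_card (pythSol_subset_image hp hpX)
    _ ≤ #(pythK p ×ˢ (univ : Finset Bool) ×ˢ pythM X p) := card_image_le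
    _ = #(pythK p) * (2 * #(pythM X p)) := by
        rw [card_product, card_product, Finset.card_univ, Fintype.card_bool]
    _ ≤ 4 * (2 * (#(normFiber X p) + 9)) := by
        gcongr
        · exact card_pythK_le p
        · exact (card_union_le _ _).trans (by gcongr; exact card_normFiber_one_le)
    _ = 8 * (#(normFiber X p) + 9) := by ring

/-- Distinct primes have disjoint norm fibers: `∑_{p ≤ X} #normFiber X p ≤ (2√X + 1)²`. [folklore] -/
theorem sum_card_normFiber_le (X : ℕ) :
    ∑ p ∈ Nat.primesLE X, #(normFiber X p) ≤ (2 * Nat.sqrt X + 1) ^ 2 := by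
  unfold normFiber
  rw [Finset.sum_card_fiberwise_eq_card_filter, ← card_fiBox]
  exact card_filter_le _ _

/-- `π(X) ≤ X + 1` (crudely). [folklore] -/
theorem card_primesLE_le (X : ℕ) : #(Nat.primesLE X) ≤ X + 1 := by
  rw [Nat.primesLE_eq_filter_range]
  exact (card_filter_le _ _).trans (by rw [card_range])

/-- The squares of primes carry few representations: `∑_{p ≤ X} a_{p²} ≤ 16 ((2√X+1)² + 9 (X+1))`.
[folklore] -/
theorem sum_fiRepCount_prime_sq_le (X : ℕ) :
    ∑ p ∈ Nat.primesLE X, fiRepCount (p ^ 2) ≤ 16 * ((2 * Nat.sqrt X + 1) ^ 2 + 9 * (X + 1)) := by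
  calc ∑ p ∈ Nat.primesLE X, fiRepCount (p ^ 2)
      ≤ ∑ p ∈ Nat.primesLE X, 16 * (#(normFiber X p) + 9) := by
        refine Finset.sum_le_sum fun p hp => ?_
        have hp' := Nat.mem_primesLE.mp hp
        calc fiRepCount (p ^ 2) ≤ 2 * #(pythSol p) := fiRepCount_sq_le p
          _ ≤ 2 * (8 * (#(normFiber X p) + 9)) := by gcongr; exact card_pythSol_le hp'.2 hp'.1
          _ = 16 * (#(normFiber X p) + 9) := by ring
    _ = 16 * (∑ p ∈ Nat.primesLE X, #(normFiber X p) + 9 * #(Nat.primesLE X)) := by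
        rw [← Finset.mul_sum, Finset.sum_add_distrib, Finset.sum_const, smul_eq_mul, mul_comm _ 9]
    _ ≤ 16 * ((2 * Nat.sqrt X + 1) ^ 2 + 9 * (X + 1)) := by
        gcongr
        · exact sum_card_normFiber_le X
        · exact card_primesLE_le X

/-! #### Prime powers `p^k`, `k ≥ 2` -/

/-- The non-primes `n ≤ x` with `Λ(n) ≠ 0` that are squares of primes. [folklore] -/
def primeSquaresLE (x : ℕ) : Finset ℕ :=
  (((Icc 1 x).filter fun n => ¬n.Prime).filter IsPrimePow).filter fun n => n.minFac ^ 2 = n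

/-- The non-primes `n ≤ x` with `Λ(n) ≠ 0` that are cubes or higher powers of primes. [folklore] -/
def higherPrimePowersLE (x : ℕ) : Finset ℕ :=
  (((Icc 1 x).filter fun n => ¬n.Prime).filter IsPrimePow).filter fun n => ¬n.minFac ^ 2 = n

/-- The prime squares `≤ x` are among `{p² : p ≤ √x prime}`. [folklore] -/
theorem primeSquaresLE_subset (x : ℕ) :
    primeSquaresLE x ⊆ (Nat.primesLE (Nat.sqrt x)).image fun p => p ^ 2 := by
  intro n hn
  simp only [primeSquaresLE, mem_filter, mem_Icc] at hn
  obtain ⟨⟨⟨⟨-, hnx⟩, -⟩, hpp⟩, hsq⟩ := hn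
  refine mem_image.mpr ⟨n.minFac, Nat.mem_primesLE.mpr ⟨?_, Nat.minFac_prime hpp.ne_one⟩, hsq⟩
  refine Nat.le_sqrt'.mpr ?_
  rw [hsq]; exact hnx

/-- The prime powers `p^k ≤ x`, `k ≥ 3`, are among `{q^k : q ≤ x^{1/3}, k ≤ log₂ x}`. [folklore] -/
theorem higherPrimePowersLE_subset (x : ℕ) :
    higherPrimePowersLE x ⊆
      (Icc 1 ⌊(x : ℝ) ^ (1 / 3 : ℝ)⌋₊ ×ˢ range (Nat.log 2 x + 1)).image fun qk => qk.1 ^ qk.2 := by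
  intro n hn
  simp only [higherPrimePowersLE, mem_filter, mem_Icc] at hn
  obtain ⟨⟨⟨⟨-, hnx⟩, hnp⟩, hpp⟩, hsq⟩ := hn
  set q := n.minFac with hq
  set k := n.factorization q with hk
  have hqk : q ^ k = n := hpp.minFac_pow_factorization_eq
  have hqp : q.Prime := Nat.minFac_prime hpp.ne_one
  have hk3 : 3 ≤ k := by
    by_contra h
    push Not at h
    interval_cases k
    · exact hpp.ne_one (by simpa using hqk.symm)
    · exact hnp (by rw [← hqk, pow_one]; exact hqp)
    · exact hsq hqk
  refine mem_image.mpr ⟨(q, k), mem_product.mpr ⟨mem_Icc.mpr ⟨hqp.one_le, ?_⟩, ?_⟩, hqk⟩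
  · refine Nat.le_floor ?_
    have h3 : (q : ℝ) ^ 3 ≤ x := by
      have : q ^ 3 ≤ x := (Nat.pow_le_pow_right hqp.pos hk3).trans (hqk ▸ hnx)
      exact_mod_cast this
    calc (q : ℝ) = ((q : ℝ) ^ 3) ^ ((3 : ℕ) : ℝ)⁻¹ :=
          (Real.pow_rpow_inv_natCast (Nat.cast_nonneg q) (by norm_num)).symm
      _ ≤ (x : ℝ) ^ ((3 : ℕ) : ℝ)⁻¹ := Real.rpow_le_rpow (by positivity) h3 (by positivity)
      _ = (x : ℝ) ^ (1 / 3 : ℝ) := by norm_num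
  · refine mem_range.mpr (Nat.lt_succ_of_le (Nat.le_log_of_pow_le one_lt_two ?_))
    calc 2 ^ k ≤ q ^ k := Nat.pow_le_pow_left hqp.two_le k
      _ = n := hqk
      _ ≤ x := hnx

/-- There are at most `x^{1/3} (log₂ x + 1)` prime powers `p^k ≤ x` with `k ≥ 3`. [folklore] -/
theorem card_higherPrimePowersLE_le (x : ℕ) :
    #(higherPrimePowersLE x) ≤ ⌊(x : ℝ) ^ (1 / 3 : ℝ)⌋₊ * (Nat.log 2 x + 1) := by
  refine (card_le_card (higherPrimePowersLE_subset x)).trans (card_image_le.trans ?_)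
  rw [card_product, Nat.card_Icc, card_range]
  simp

/-- On `n ≤ x`, `a_n Λ(n) ≤ a_n log x`. [folklore] -/
theorem fiRepCount_mul_vonMangoldt_le {n x : ℕ} (hn : n ∈ Icc 1 x) :
    (fiRepCount n : ℝ) * Λ n ≤ fiRepCount n * Real.log x := by
  have h := mem_Icc.mp hn
  refine mul_le_mul_of_nonneg_left ?_ (Nat.cast_nonneg _)
  calc (Λ n : ℝ) ≤ Real.log n := ArithmeticFunction.vonMangoldt_le_log
    _ ≤ Real.log x := Real.log_le_log (by exact_mod_cast h.1) (by exact_mod_cast h.2)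

/-- Squares of primes: `∑_{n = p² ≤ x} a_n Λ(n) ≤ log x · 16 ((2 x^{1/4} + 1)² + 9 (√x + 1))`.
[folklore] -/
theorem sum_primeSquaresLE_le (x : ℕ) :
    ∑ n ∈ primeSquaresLE x, (fiRepCount n : ℝ) * Λ n ≤
      Real.log x * (16 * ((2 * Nat.sqrt (Nat.sqrt x) + 1) ^ 2 + 9 * (Nat.sqrt x + 1)) : ℕ) := by
  have hlog : 0 ≤ Real.log x := Real.log_natCast_nonneg x
  calc ∑ n ∈ primeSquaresLE x, (fiRepCount n : ℝ) * Λ n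
      ≤ ∑ n ∈ primeSquaresLE x, (fiRepCount n : ℝ) * Real.log x :=
        Finset.sum_le_sum fun n hn => fiRepCount_mul_vonMangoldt_le (by
          simp only [primeSquaresLE, mem_filter] at hn; exact hn.1.1.1)
    _ = Real.log x * ∑ n ∈ primeSquaresLE x, (fiRepCount n : ℝ) := by
        rw [Finset.mul_sum]; refine Finset.sum_congr rfl fun n _ => ?_; ring
    _ ≤ Real.log x * ∑ n ∈ (Nat.primesLE (Nat.sqrt x)).image (fun p => p ^ 2),
          (fiRepCount n : ℝ) := by
        apply mul_le_mul_of_nonneg_left _ hlog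
        exact Finset.sum_le_sum_of_subset_of_nonneg (primeSquaresLE_subset x)
          fun n _ _ => by positivity
    _ = Real.log x * ((∑ p ∈ Nat.primesLE (Nat.sqrt x), fiRepCount (p ^ 2) : ℕ) : ℝ) := by
        rw [Finset.sum_image fun a _ b _ h => (Nat.pow_left_injective two_ne_zero) h]
        push_cast; rfl
    _ ≤ Real.log x * (16 * ((2 * Nat.sqrt (Nat.sqrt x) + 1) ^ 2 + 9 * (Nat.sqrt x + 1)) : ℕ) := by
        gcongr
        exact_mod_cast sum_fiRepCount_prime_sq_le (Nat.sqrt x)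

/-- Higher prime powers: `∑_{n = p^k ≤ x, k ≥ 3} a_n Λ(n) ≤ #· 2(2x^{1/4}+1) log x`. [folklore] -/
theorem sum_higherPrimePowersLE_le (x : ℕ) :
    ∑ n ∈ higherPrimePowersLE x, (fiRepCount n : ℝ) * Λ n ≤
      (⌊(x : ℝ) ^ (1 / 3 : ℝ)⌋₊ * (Nat.log 2 x + 1) : ℕ) *
        ((2 * (2 * Nat.sqrt (Nat.sqrt x) + 1) : ℕ) * Real.log x) := by
  have hlog : 0 ≤ Real.log x := Real.log_natCast_nonneg x
  have hterm : ∀ n ∈ higherPrimePowersLE x, (fiRepCount n : ℝ) * Λ n ≤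
      (2 * (2 * Nat.sqrt (Nat.sqrt x) + 1) : ℕ) * Real.log x := by
    intro n hn
    have hn' : n ∈ Icc 1 x := by
      simp only [higherPrimePowersLE, mem_filter] at hn; exact hn.1.1.1
    have h1 : fiRepCount n ≤ 2 * (2 * Nat.sqrt (Nat.sqrt x) + 1) :=
      (fiRepCount_le n).trans (by
        gcongr
        exact (mem_Icc.mp hn').2)
    have h2 : (fiRepCount n : ℝ) ≤ (2 * (2 * Nat.sqrt (Nat.sqrt x) + 1) : ℕ) := by exact_mod_cast h1
    exact (fiRepCount_mul_vonMangoldt_le hn').trans (mul_le_mul_of_nonneg_right h2 hlog)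
  calc ∑ n ∈ higherPrimePowersLE x, (fiRepCount n : ℝ) * Λ n
      ≤ #(higherPrimePowersLE x) • ((2 * (2 * Nat.sqrt (Nat.sqrt x) + 1) : ℕ) * Real.log x) :=
        Finset.sum_le_card_nsmul _ _ _ hterm
    _ ≤ (⌊(x : ℝ) ^ (1 / 3 : ℝ)⌋₊ * (Nat.log 2 x + 1) : ℕ) •
          ((2 * (2 * Nat.sqrt (Nat.sqrt x) + 1) : ℕ) * Real.log x) :=
        nsmul_le_nsmul_left (by positivity) (card_higherPrimePowersLE_le x)
    _ = _ := by rw [nsmul_eq_mul]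

/-- **The prime powers `p^k`, `k ≥ 2`, are negligible**: the pointwise bound. [folklore] -/
theorem sum_nonprime_le (x : ℕ) :
    ∑ n ∈ (Icc 1 x).filter (fun n => ¬n.Prime), (fiRepCount n : ℝ) * Λ n ≤
      Real.log x * (16 * ((2 * Nat.sqrt (Nat.sqrt x) + 1) ^ 2 + 9 * (Nat.sqrt x + 1)) : ℕ) +
      (⌊(x : ℝ) ^ (1 / 3 : ℝ)⌋₊ * (Nat.log 2 x + 1) : ℕ) *
        ((2 * (2 * Nat.sqrt (Nat.sqrt x) + 1) : ℕ) * Real.log x) := by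
  rw [← Finset.sum_filter_of_ne (p := IsPrimePow) (fun n _ h => ?_)]
  · rw [← Finset.sum_filter_add_sum_filter_not _ (fun n => n.minFac ^ 2 = n)]
    exact add_le_add (sum_primeSquaresLE_le x) (sum_higherPrimePowersLE_le x)
  · by_contra hn
    exact h (by rw [ArithmeticFunction.vonMangoldt_eq_zero_iff.mpr hn, mul_zero])

/-! #### The pointwise error bound -/

/-- The bookkeeping identity `4 F(x) - S(x) = E₁(x) - Axis(x)`. [folklore] -/
theorem four_mul_friedlanderIwaniecSum_sub_fiPrimeSum (x : ℕ) :
    4 * friedlanderIwaniecSum x - fiPrimeSum x =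
      ∑ n ∈ (Icc 1 x).filter (fun n => ¬n.Prime), (fiRepCount n : ℝ) * Λ n -
        ∑ ac ∈ (fiPoints x).filter (fun ac => ¬(ac.1 ≠ 0 ∧ ac.2 ≠ 0)), (Λ (fiQuartic ac) : ℝ) := by
  have h1 := sum_fiRepCount_mul_vonMangoldt x
  have h2 := sum_fiRepCount_mul_vonMangoldt_eq_add x
  have h3 := Finset.sum_filter_add_sum_filter_not (fiPoints x) (fun ac => ac.1 ≠ 0 ∧ ac.2 ≠ 0)
    (fun ac => (Λ (fiQuartic ac) : ℝ))
  rw [sum_fiPoints_offAxis] at h3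
  linarith

/-- The raw pointwise bound `|4 F(x) - S(x)| ≤ E₁-bound + Axis-bound`. [folklore] -/
theorem abs_four_mul_sub_fiPrimeSum_le_raw (x : ℕ) :
    |4 * friedlanderIwaniecSum x - fiPrimeSum x| ≤
      Real.log x * (16 * ((2 * Nat.sqrt (Nat.sqrt x) + 1) ^ 2 + 9 * (Nat.sqrt x + 1)) : ℕ) +
      (⌊(x : ℝ) ^ (1 / 3 : ℝ)⌋₊ * (Nat.log 2 x + 1) : ℕ) *
        ((2 * (2 * Nat.sqrt (Nat.sqrt x) + 1) : ℕ) * Real.log x) +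
      2 * (2 * Nat.sqrt x + 1) * Real.log x := by
  rw [four_mul_friedlanderIwaniecSum_sub_fiPrimeSum]
  have hE := sum_nonprime_le x
  have hA := sum_fiPoints_axis_le x
  have hE0 : 0 ≤ ∑ n ∈ (Icc 1 x).filter (fun n => ¬n.Prime), (fiRepCount n : ℝ) * Λ n :=
    Finset.sum_nonneg fun n _ => mul_nonneg (Nat.cast_nonneg _) ArithmeticFunction.vonMangoldt_nonneg
  have hA0 : 0 ≤ ∑ ac ∈ (fiPoints x).filter (fun ac => ¬(ac.1 ≠ 0 ∧ ac.2 ≠ 0)),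
      (Λ (fiQuartic ac) : ℝ) :=
    Finset.sum_nonneg fun _ _ => ArithmeticFunction.vonMangoldt_nonneg
  rw [abs_le]; constructor <;> linarith

/-- **The elementary error term**: for `x ≥ 1`,
`|4 ∑∑_{a, b ≥ 1, a² + b⁴ ≤ x} Λ(a² + b⁴) - ∑_{p ≤ x} a_p log p| ≤ 450 x^{7/12} (1 + log x)²`
(prime powers and the coordinate axes). [folklore] -/
theorem abs_four_mul_sub_fiPrimeSum_le {x : ℕ} (hx : 1 ≤ x) :
    |4 * friedlanderIwaniecSum x - fiPrimeSum x| ≤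
      450 * (x : ℝ) ^ (7 / 12 : ℝ) * (1 + Real.log x) ^ 2 := by
  refine (abs_four_mul_sub_fiPrimeSum_le_raw x).trans ?_
  set u : ℝ := (x : ℝ) ^ (1 / 12 : ℝ) with hu
  set L : ℝ := Real.log x with hL
  have hx0 : (0 : ℝ) ≤ x := Nat.cast_nonneg x
  have hx1 : (1 : ℝ) ≤ x := by exact_mod_cast hx
  have hu1 : 1 ≤ u := Real.one_le_rpow hx1 (by norm_num)
  have hu0 : 0 ≤ u := zero_le_one.trans hu1
  have hL0 : 0 ≤ L := Real.log_nonneg hx1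
  have hupow : ∀ k : ℕ, u ^ k = (x : ℝ) ^ ((k : ℝ) / 12) := fun k => by
    rw [hu, ← Real.rpow_natCast, ← Real.rpow_mul hx0]; congr 1; ring
  have hx12 : (x : ℝ) = u ^ 12 := by rw [hupow]; norm_num
  have hr2 : (Nat.sqrt x : ℝ) ≤ u ^ 6 := by
    refine le_of_pow_le_pow_left₀ two_ne_zero (by positivity) ?_
    calc (Nat.sqrt x : ℝ) ^ 2 = ((Nat.sqrt x ^ 2 : ℕ) : ℝ) := by push_cast; ring
      _ ≤ x := by exact_mod_cast Nat.sqrt_le' x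
      _ = (u ^ 6) ^ 2 := by rw [hx12]; ring
  have hr4 : (Nat.sqrt (Nat.sqrt x) : ℝ) ≤ u ^ 3 := by
    refine le_of_pow_le_pow_left₀ (by norm_num : 4 ≠ 0) (by positivity) ?_
    have h : Nat.sqrt (Nat.sqrt x) ^ 4 ≤ x := by
      calc Nat.sqrt (Nat.sqrt x) ^ 4 = (Nat.sqrt (Nat.sqrt x) ^ 2) ^ 2 := by ring
        _ ≤ (Nat.sqrt x) ^ 2 := Nat.pow_le_pow_left (Nat.sqrt_le' _) 2
        _ ≤ x := Nat.sqrt_le' x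
    calc (Nat.sqrt (Nat.sqrt x) : ℝ) ^ 4 = ((Nat.sqrt (Nat.sqrt x) ^ 4 : ℕ) : ℝ) := by push_cast; ring
      _ ≤ x := by exact_mod_cast h
      _ = (u ^ 3) ^ 4 := by rw [hx12]; ring
  have hc3 : (⌊(x : ℝ) ^ (1 / 3 : ℝ)⌋₊ : ℝ) ≤ u ^ 4 := by
    refine (Nat.floor_le (by positivity)).trans (le_of_eq ?_)
    rw [hupow]; norm_num
  have hl : (Nat.log 2 x : ℝ) ≤ 2 * L := by
    have h1 : (2 : ℝ) ^ Nat.log 2 x ≤ x := by exact_mod_cast Nat.pow_log_le_self 2 (by omega)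
    have h2 : (Nat.log 2 x : ℝ) * Real.log 2 ≤ L := by
      rw [← Real.log_pow]; exact Real.log_le_log (by positivity) h1
    have h3 : (1 : ℝ) / 2 ≤ Real.log 2 := by linarith [Real.log_two_gt_d9]
    nlinarith
  have h7 : (x : ℝ) ^ (7 / 12 : ℝ) = u ^ 7 := by rw [hupow]; norm_num
  rw [h7]
  push_cast
  have m3 : u ^ 3 * L ≤ u ^ 7 * L :=
    mul_le_mul_of_nonneg_right (pow_le_pow_right₀ hu1 (by norm_num)) hL0
  have m4 : u ^ 4 * L ≤ u ^ 7 * L :=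
    mul_le_mul_of_nonneg_right (pow_le_pow_right₀ hu1 (by norm_num)) hL0
  have m6 : u ^ 6 * L ≤ u ^ 7 * L :=
    mul_le_mul_of_nonneg_right (pow_le_pow_right₀ hu1 (by norm_num)) hL0
  have m0 : L ≤ u ^ 7 * L := le_mul_of_one_le_left hL0 (one_le_pow₀ hu1)
  have m4' : u ^ 4 * L ^ 2 ≤ u ^ 7 * L ^ 2 :=
    mul_le_mul_of_nonneg_right (pow_le_pow_right₀ hu1 (by norm_num)) (sq_nonneg L)
  have n0 : 0 ≤ u ^ 7 := by positivity
  have n1 : 0 ≤ u ^ 7 * L := by positivity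
  have n2 : 0 ≤ u ^ 7 * L ^ 2 := by positivity
  calc L * (16 * ((2 * (Nat.sqrt (Nat.sqrt x) : ℝ) + 1) ^ 2 + 9 * ((Nat.sqrt x : ℝ) + 1))) +
        (⌊(x : ℝ) ^ (1 / 3 : ℝ)⌋₊ : ℝ) * ((Nat.log 2 x : ℝ) + 1) *
          (2 * (2 * (Nat.sqrt (Nat.sqrt x) : ℝ) + 1) * L) +
        2 * (2 * (Nat.sqrt x : ℝ) + 1) * L
      ≤ L * (16 * ((2 * u ^ 3 + 1) ^ 2 + 9 * (u ^ 6 + 1))) +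
        u ^ 4 * (2 * L + 1) * (2 * (2 * u ^ 3 + 1) * L) + 2 * (2 * u ^ 6 + 1) * L := by
        gcongr
    _ ≤ 450 * u ^ 7 * (1 + L) ^ 2 := by nlinarith [m3, m4, m6, m0, m4', n0, n1, n2]

/-! #### Asymptotics -/

/-- `x^{7/12} (1 + log x)² = o(x^{3/4})` along `ℕ`. [folklore] -/
theorem isLittleO_errorTerm :
    (fun x : ℕ => (450 : ℝ) * (x : ℝ) ^ (7 / 12 : ℝ) * (1 + Real.log x) ^ 2) =o[atTop]
      fun x : ℕ => (x : ℝ) ^ (3 / 4 : ℝ) := by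
  have h1 : (fun x : ℝ => (1 + Real.log x) ^ 2) =o[atTop] fun x : ℝ => x ^ (1 / 6 : ℝ) := by
    have hlog2 : (fun x : ℝ => Real.log x ^ 2) =o[atTop] fun x : ℝ => x ^ (1 / 6 : ℝ) := by
      refine (isLittleO_log_rpow_rpow_atTop (s := 1 / 6) 2 (by norm_num)).congr_left fun x => ?_
      exact Real.rpow_two _
    refine IsBigO.trans_isLittleO (IsBigO.of_bound 4 ?_) hlog2
    filter_upwards [eventually_ge_atTop (Real.exp 1)] with x hx
    have hl : 1 ≤ Real.log x := by
      rw [Real.le_log_iff_exp_le ((Real.exp_pos 1).trans_le hx)]; exact hx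
    rw [Real.norm_eq_abs, Real.norm_eq_abs, abs_of_nonneg (by positivity),
      abs_of_nonneg (by positivity)]
    nlinarith
  have h2 : (fun x : ℝ => (450 : ℝ) * x ^ (7 / 12 : ℝ) * (1 + Real.log x) ^ 2) =o[atTop]
      fun x : ℝ => x ^ (3 / 4 : ℝ) := by
    have h3 : (fun x : ℝ => (450 : ℝ) * x ^ (7 / 12 : ℝ)) =O[atTop] fun x : ℝ => x ^ (7 / 12 : ℝ) :=
      (isBigO_refl _ _).const_mul_left 450
    refine (h3.mul_isLittleO h1).congr' EventuallyEq.rfl ?_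
    filter_upwards [eventually_gt_atTop 0] with x hx
    rw [← Real.rpow_add hx]; norm_num
  exact h2.comp_tendsto tendsto_natCast_atTop_atTop

/-- `4 F(x) - S(x) = o(x^{3/4})` along `ℕ`. [folklore] -/
theorem isLittleO_four_mul_sub_fiPrimeSum :
    (fun x : ℕ => 4 * friedlanderIwaniecSum x - fiPrimeSum x) =o[atTop]
      fun x : ℕ => (x : ℝ) ^ (3 / 4 : ℝ) := by
  refine IsBigO.trans_isLittleO (IsBigO.of_bound 1 ?_) isLittleO_errorTerm
  filter_upwards [eventually_ge_atTop 1] with x hx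
  have h0 : (0 : ℝ) ≤ 450 * (x : ℝ) ^ (7 / 12 : ℝ) * (1 + Real.log x) ^ 2 := by positivity
  rw [one_mul, Real.norm_eq_abs, Real.norm_eq_abs, abs_of_nonneg h0]
  exact abs_four_mul_sub_fiPrimeSum_le hx

/-- `x^{1/2} = o(x^{3/4})`. [folklore] -/
theorem isLittleO_rpow_half_rpow_three_quarters :
    (fun x : ℝ => x ^ (1 / 2 : ℝ)) =o[atTop] fun x : ℝ => x ^ (3 / 4 : ℝ) := by
  have h : (fun x : ℝ => x ^ (-(1 / 4) : ℝ)) =o[atTop] (fun _ => (1 : ℝ)) := by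
    rw [isLittleO_one_iff]; exact tendsto_rpow_neg_atTop (by norm_num)
  refine ((isBigO_refl (fun x : ℝ => x ^ (3 / 4 : ℝ)) atTop).mul_isLittleO h).congr' ?_ ?_
  · filter_upwards [eventually_gt_atTop 0] with x hx
    rw [← Real.rpow_add hx]; norm_num
  · exact Eventually.of_forall fun x => mul_one _

/-- From (4.2) and (4.7)–(4.8): `∑_{p ≤ x} a_p log p = (16/π) κ x^{3/4} + o(x^{3/4})`. [folklore] -/
theorem isLittleO_fiPrimeSum_sub (h42 : FriedlanderIwaniec1998_count_asymp)
    (h47 : FriedlanderIwaniec1998_primeSum_asymp) :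
    (fun x : ℝ => fiPrimeSum x - 16 / Real.pi * friedlanderIwaniecKappa * x ^ (3 / 4 : ℝ)) =o[atTop]
      fun x : ℝ => x ^ (3 / 4 : ℝ) := by
  have hA : (fun x : ℝ => fiCount x - 4 * friedlanderIwaniecKappa * x ^ (3 / 4 : ℝ)) =o[atTop]
      fun x : ℝ => x ^ (3 / 4 : ℝ) :=
    h42.trans_isLittleO isLittleO_rpow_half_rpow_three_quarters
  have hA' : (fun x : ℝ => fiCount x) =O[atTop] fun x : ℝ => x ^ (3 / 4 : ℝ) := by
    have hm : (fun x : ℝ => 4 * friedlanderIwaniecKappa * x ^ (3 / 4 : ℝ)) =O[atTop]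
        fun x : ℝ => x ^ (3 / 4 : ℝ) := (isBigO_refl _ _).const_mul_left _
    refine (hA.isBigO.add hm).congr_left fun x => ?_
    ring
  have hr : Tendsto (fun x : ℝ => Real.log (Real.log x) / Real.log x) atTop (𝓝 0) :=
    (Real.isLittleO_log_id_atTop.tendsto_div_nhds_zero).comp Real.tendsto_log_atTop
  have hr' : (fun x : ℝ => Real.log (Real.log x) / Real.log x) =o[atTop] (fun _ => (1 : ℝ)) := by
    rwa [isLittleO_one_iff]
  have hP : (fun x : ℝ => fiPrimeSum x - 4 / Real.pi * fiCount x) =o[atTop]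
      fun x : ℝ => x ^ (3 / 4 : ℝ) := by
    refine h47.trans_isLittleO ?_
    have h1 : (fun x : ℝ => 4 / Real.pi * fiCount x) =O[atTop] fun x : ℝ => x ^ (3 / 4 : ℝ) :=
      hA'.const_mul_left _
    exact (h1.mul_isLittleO hr').congr_right fun x => mul_one _
  have heq : (fun x : ℝ => fiPrimeSum x - 16 / Real.pi * friedlanderIwaniecKappa * x ^ (3 / 4 : ℝ)) =
      fun x => (fiPrimeSum x - 4 / Real.pi * fiCount x) +
        4 / Real.pi * (fiCount x - 4 * friedlanderIwaniecKappa * x ^ (3 / 4 : ℝ)) := by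
    funext x; ring
  rw [heq]
  exact hP.add (hA.const_mul_left _)

/-! #### The lattice-point count (4.2): `A(x) = 4 κ x^{3/4} + O(x^{1/2})` -/

/-- The lattice points `(a, c) ∈ ℤ²` with `a² + c⁴ ≤ N`, origin included (they lie in `[-N, N]²`).
[folklore] -/
def fiDisc (N : ℕ) : Finset (ℤ × ℤ) := {ac ∈ fiBox N | ac.1 ^ 2 + ac.2 ^ 4 ≤ (N : ℤ)}

/-- `A(N) + 1 = #{(a, c) ∈ ℤ² : a² + c⁴ ≤ N}` (the origin is the only point with `a² + c⁴ = 0`).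
[folklore] -/
theorem sum_fiRepCount_add_one (N : ℕ) : ∑ n ∈ Icc 1 N, fiRepCount n + 1 = #(fiDisc N) := by
  have h1 : ∑ n ∈ Icc 1 N, fiRepCount n =
      #{ac ∈ fiBox N | (ac.1 ^ 2 + ac.2 ^ 4).toNat ∈ Icc 1 N} := by
    rw [← Finset.sum_card_fiberwise_eq_card_filter]
    refine Finset.sum_congr rfl fun n hn => ?_
    rw [fiRepCount_eq_card (mem_Icc.mp hn).2]
    congr 1
    ext ac
    simp only [mem_filter]
    refine and_congr_right fun _ => ?_
    have h0 : 0 ≤ ac.1 ^ 2 + ac.2 ^ 4 := by positivity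
    constructor
    · intro h; rw [h, Int.toNat_natCast]
    · intro h; rw [← h, Int.toNat_of_nonneg h0]
  have h2 : fiDisc N =
      insert ((0 : ℤ), (0 : ℤ)) {ac ∈ fiBox N | (ac.1 ^ 2 + ac.2 ^ 4).toNat ∈ Icc 1 N} := by
    ext ⟨a, c⟩
    simp only [fiDisc, mem_filter, mem_insert, mem_Icc, Prod.mk.injEq]
    constructor
    · rintro ⟨hb, hle⟩
      by_cases h0 : a = 0 ∧ c = 0
      · exact Or.inl h0
      · refine Or.inr ⟨hb, ?_, Int.toNat_le.mpr hle⟩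
        have h0' : (0 : ℤ) ≤ a ^ 2 + c ^ 4 := by positivity
        refine (Int.le_toNat h0').mpr ?_
        rcases not_and_or.mp h0 with ha | hc
        · have := sq_pos_of_ne_zero ha
          push_cast
          nlinarith [sq_nonneg (c ^ 2)]
        · have := sq_pos_of_ne_zero hc
          push_cast
          nlinarith [sq_nonneg a, sq_nonneg c]
    · rintro (⟨rfl, rfl⟩ | ⟨hb, -, h2⟩)
      · refine ⟨?_, by positivity⟩
        simp [fiBox]
      · exact ⟨hb, Int.toNat_le.mp h2⟩
  rw [h2, card_insert_of_notMem (by simp), h1]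

/-- Slicing by `c`: `#{a² + c⁴ ≤ N} = ∑_{|c| ≤ N} #{a ∈ [-N, N] : a² + c⁴ ≤ N}`. [folklore] -/
theorem card_fiDisc_eq_sum (N : ℕ) :
    #(fiDisc N) = ∑ c ∈ Icc (-(N : ℤ)) N, #{a ∈ Icc (-(N : ℤ)) N | a ^ 2 + c ^ 4 ≤ (N : ℤ)} := by
  rw [fiDisc, fiBox, card_filter, sum_product_right]
  simp only [card_filter]

/-- A slice with `c⁴ ≤ N` has `2 ⌊√(N - c⁴)⌋ + 1` points. [folklore] -/
theorem card_slice_eq {N : ℕ} {c : ℤ} (hc : c ^ 4 ≤ (N : ℤ)) :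
    #{a ∈ Icc (-(N : ℤ)) N | a ^ 2 + c ^ 4 ≤ (N : ℤ)} =
      2 * Nat.sqrt ((N : ℤ) - c ^ 4).toNat + 1 := by
  set M := ((N : ℤ) - c ^ 4).toNat with hM
  have hMz : (M : ℤ) = N - c ^ 4 := Int.toNat_of_nonneg (by linarith)
  have hc0 : 0 ≤ c ^ 4 := by positivity
  have hMN : M ≤ N := by
    have : (M : ℤ) ≤ N := by rw [hMz]; linarith
    exact_mod_cast this
  have hset : {a ∈ Icc (-(N : ℤ)) N | a ^ 2 + c ^ 4 ≤ (N : ℤ)} =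
      Icc (-(Nat.sqrt M : ℤ)) (Nat.sqrt M) := by
    ext a
    simp only [mem_filter, mem_Icc]
    constructor
    · rintro ⟨-, h⟩
      have : a ^ 2 ≤ (M : ℤ) := by rw [hMz]; linarith
      exact mem_Icc.mp (mem_Icc_sqrt_of_sq_le this)
    · rintro ⟨h1, h2⟩
      have hs : ((Nat.sqrt M) ^ 2 : ℕ) ≤ M := Nat.sqrt_le' M
      have hs' : (Nat.sqrt M : ℤ) ^ 2 ≤ M := by exact_mod_cast hs
      have ha2 : a ^ 2 ≤ (Nat.sqrt M : ℤ) ^ 2 := by nlinarith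
      have hsN : (Nat.sqrt M : ℤ) ≤ N := by exact_mod_cast (Nat.sqrt_le_self M).trans hMN
      refine ⟨⟨by linarith, by linarith⟩, ?_⟩
      linarith
  rw [hset, Int.card_Icc]
  omega

/-- A slice with `c⁴ > N` is empty. [folklore] -/
theorem card_slice_eq_zero {N : ℕ} {c : ℤ} (hc : (N : ℤ) < c ^ 4) :
    #{a ∈ Icc (-(N : ℤ)) N | a ^ 2 + c ^ 4 ≤ (N : ℤ)} = 0 := by
  rw [card_eq_zero, filter_eq_empty_iff]
  intro a _ h
  nlinarith [sq_nonneg a]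

/-- There are at most `2√N + 1` integers `c` with `c⁴ ≤ N` (crudely, via `c² ≤ c⁴`). [folklore] -/
theorem card_filter_pow_four_le (N : ℕ) :
    #{c ∈ Icc (-(N : ℤ)) N | c ^ 4 ≤ (N : ℤ)} ≤ 2 * Nat.sqrt N + 1 := by
  have hsub : {c ∈ Icc (-(N : ℤ)) N | c ^ 4 ≤ (N : ℤ)} ⊆ Icc (-(Nat.sqrt N : ℤ)) (Nat.sqrt N) := by
    intro c hc
    have h := (mem_filter.mp hc).2
    refine mem_Icc_sqrt_of_sq_le ?_
    calc c ^ 2 ≤ (c ^ 2) ^ 2 := Int.le_self_sq _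
      _ = c ^ 4 := by ring
      _ ≤ N := h
  refine (card_le_card hsub).trans ?_
  rw [Int.card_Icc]; omega

/-- The real slice function `g(t) = √(x - t⁴)` (`= 0` for `t⁴ ≥ x`). [folklore] -/
def fiSlice (x t : ℝ) : ℝ := Real.sqrt (x - t ^ 4)

/-- `g` is even. [folklore] -/
theorem fiSlice_neg (x t : ℝ) : fiSlice x (-t) = fiSlice x t := by
  rw [fiSlice, fiSlice, show (-t) ^ 4 = t ^ 4 by ring]

/-- `g(0) = √x`. [folklore] -/
theorem fiSlice_zero (x : ℝ) : fiSlice x 0 = Real.sqrt x := by simp [fiSlice]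

/-- `g ≥ 0`. [folklore] -/
theorem fiSlice_nonneg (x t : ℝ) : 0 ≤ fiSlice x t := Real.sqrt_nonneg _

/-- `g(t) = 0` once `t⁴ ≥ x`. [folklore] -/
theorem fiSlice_eq_zero {x t : ℝ} (h : x ≤ t ^ 4) : fiSlice x t = 0 :=
  Real.sqrt_eq_zero_of_nonpos (by linarith)

/-- `g` is decreasing on `[0, ∞)`. [folklore] -/
theorem fiSlice_antitoneOn (x : ℝ) : AntitoneOn (fiSlice x) (Set.Ici 0) := by
  intro s hs t _ hst
  simp only [fiSlice]
  refine Real.sqrt_le_sqrt ?_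
  have : s ^ 4 ≤ t ^ 4 := pow_le_pow_left₀ hs hst 4
  linarith

/-- `g` is continuous. [folklore] -/
theorem continuous_fiSlice (x : ℝ) : Continuous (fiSlice x) :=
  (continuous_const.sub (continuous_pow 4)).sqrt

/-- Each slice count is `2 g(c) + [c⁴ ≤ N]` up to an error `≤ 2 [c⁴ ≤ N]`; recorded as
`|#slice(c) - 2 g(c)| ≤ 3 [c⁴ ≤ N]`. [folklore] -/
theorem abs_card_slice_sub_le {x : ℝ} (hx : 0 ≤ x) (c : ℤ) :
    |(#{a ∈ Icc (-(⌊x⌋₊ : ℤ)) ⌊x⌋₊ | a ^ 2 + c ^ 4 ≤ (⌊x⌋₊ : ℤ)} : ℝ) - 2 * fiSlice x c| ≤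
      if c ^ 4 ≤ (⌊x⌋₊ : ℤ) then 3 else 0 := by
  set N := ⌊x⌋₊ with hN
  have hNx : (N : ℝ) ≤ x := Nat.floor_le hx
  have hxN : x < N + 1 := Nat.lt_floor_add_one x
  split_ifs with hc
  · rw [card_slice_eq hc]
    set M := ((N : ℤ) - c ^ 4).toNat with hM
    have hMz : (M : ℤ) = N - c ^ 4 := Int.toNat_of_nonneg (by linarith)
    have hMr : (M : ℝ) = N - (c : ℝ) ^ 4 := by exact_mod_cast hMz
    set s := Nat.sqrt M with hs
    -- `s ≤ g(c) ≤ s + 1`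
    have h1 : (s : ℝ) ≤ fiSlice x c := by
      have hs2 : ((s ^ 2 : ℕ) : ℝ) ≤ M := by exact_mod_cast Nat.sqrt_le' M
      calc (s : ℝ) = Real.sqrt ((s : ℝ) ^ 2) := (Real.sqrt_sq (Nat.cast_nonneg s)).symm
        _ ≤ Real.sqrt (x - (c : ℝ) ^ 4) := Real.sqrt_le_sqrt (by push_cast at hs2; linarith)
    have h2 : fiSlice x c ≤ s + 1 := by
      have hM1 : M < (s + 1) ^ 2 := Nat.lt_succ_sqrt' M
      have hM1' : ((M : ℝ) + 1) ≤ ((s : ℝ) + 1) ^ 2 := by exact_mod_cast hM1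
      calc fiSlice x c = Real.sqrt (x - (c : ℝ) ^ 4) := rfl
        _ ≤ Real.sqrt (((s : ℝ) + 1) ^ 2) := Real.sqrt_le_sqrt (by linarith)
        _ = s + 1 := Real.sqrt_sq (by positivity)
    rw [abs_le]
    push_cast
    constructor <;> linarith
  · push Not at hc
    rw [card_slice_eq_zero hc, fiSlice_eq_zero]
    · simp
    · have : ((N : ℤ) + 1 : ℝ) ≤ ((c ^ 4 : ℤ) : ℝ) := by exact_mod_cast hc
      push_cast at this
      linarith

/-- `|#{a² + c⁴ ≤ ⌊x⌋} - 2 ∑_{|c| ≤ ⌊x⌋} g(c)| ≤ 3 (2√x + 1)`. [folklore] -/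
theorem abs_card_fiDisc_sub_sum_le {x : ℝ} (hx : 0 ≤ x) :
    |(#(fiDisc ⌊x⌋₊) : ℝ) - 2 * ∑ c ∈ Icc (-(⌊x⌋₊ : ℤ)) ⌊x⌋₊, fiSlice x c| ≤
      3 * (2 * Real.sqrt x + 1) := by
  set N := ⌊x⌋₊ with hN
  rw [card_fiDisc_eq_sum, Nat.cast_sum, mul_sum, ← sum_sub_distrib]
  refine (abs_sum_le_sum_abs _ _).trans ?_
  refine (sum_le_sum fun c _ => abs_card_slice_sub_le hx c).trans ?_
  rw [← sum_filter, sum_const, nsmul_eq_mul]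
  have h1 : (#{c ∈ Icc (-(N : ℤ)) N | c ^ 4 ≤ (N : ℤ)} : ℝ) ≤ 2 * Nat.sqrt N + 1 := by
    exact_mod_cast card_filter_pow_four_le N
  have h2 : (Nat.sqrt N : ℝ) ≤ Real.sqrt x :=
    Real.nat_sqrt_le_real_sqrt.trans (Real.sqrt_le_sqrt (Nat.floor_le hx))
  linarith

/-- Evenness: `∑_{|c| ≤ N} g(c) = g(0) + 2 ∑_{1 ≤ c ≤ N} g(c)`. [folklore] -/
theorem sum_Icc_fiSlice (x : ℝ) (N : ℕ) :
    ∑ c ∈ Icc (-(N : ℤ)) N, fiSlice x c = fiSlice x 0 + 2 * ∑ c ∈ Icc 1 N, fiSlice x c := by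
  rw [← Finset.sum_filter_add_sum_filter_not (Icc (-(N : ℤ)) N) (· = 0)]
  have h0 : (Icc (-(N : ℤ)) N).filter (· = 0) = {0} := by
    ext c; simp only [mem_filter, mem_Icc, mem_singleton]; constructor
    · rintro ⟨-, rfl⟩; rfl
    · rintro rfl; exact ⟨⟨by omega, by omega⟩, rfl⟩
  rw [h0, sum_singleton, Int.cast_zero]
  congr 1
  rw [sum_Icc_neg_filter_ne_zero (h := fun c : ℤ => fiSlice x c) (fun c => by
    rw [Int.cast_neg, fiSlice_neg]), sum_Icc_int_eq_sum_Icc_nat]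
  simp

/-- Sum versus integral for the decreasing function `g` on `[0, N + 1]`, using `g(N + 1) = 0`:
`∑_{1 ≤ c ≤ N} g(c) ≤ ∫₀^{N+1} g ≤ ∑_{1 ≤ c ≤ N} g(c) + g(0)`. [folklore] -/
theorem sum_le_integral_fiSlice (x : ℝ) :
    ∑ c ∈ Icc 1 ⌊x⌋₊, fiSlice x c ≤ ∫ t in (0 : ℝ)..(⌊x⌋₊ + 1 : ℕ), fiSlice x t ∧
    ∫ t in (0 : ℝ)..(⌊x⌋₊ + 1 : ℕ), fiSlice x t ≤ ∑ c ∈ Icc 1 ⌊x⌋₊, fiSlice x c + fiSlice x 0 := by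
  set N := ⌊x⌋₊ with hN
  have hanti : AntitoneOn (fiSlice x) (Set.Icc (0 : ℝ) (0 + (N + 1 : ℕ))) :=
    (fiSlice_antitoneOn x).mono fun t ht => ht.1
  have hlow := hanti.sum_le_integral
  have hup := hanti.integral_le_sum
  simp only [zero_add] at hlow hup
  have hIcc : ∑ c ∈ Icc 1 N, fiSlice x c = ∑ i ∈ range N, fiSlice x ((i + 1 : ℕ) : ℝ) := by
    rw [← Finset.Ico_add_one_right_eq_Icc, sum_Ico_eq_sum_range]
    refine sum_congr (by simp) fun i _ => ?_
    rw [add_comm]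
  have hzero : fiSlice x ((N + 1 : ℕ) : ℝ) = 0 := by
    refine fiSlice_eq_zero ?_
    have h1 : x < (N + 1 : ℕ) := by push_cast; exact Nat.lt_floor_add_one x
    have h2 : (1 : ℝ) ≤ (N + 1 : ℕ) := by exact_mod_cast Nat.le_add_left 1 N
    calc x ≤ ((N + 1 : ℕ) : ℝ) := h1.le
      _ ≤ ((N + 1 : ℕ) : ℝ) ^ 4 := le_self_pow₀ h2 (by norm_num)
  constructor
  · calc ∑ c ∈ Icc 1 N, fiSlice x c = ∑ i ∈ range (N + 1), fiSlice x ((i + 1 : ℕ) : ℝ) := by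
          rw [sum_range_succ, hzero, add_zero, hIcc]
      _ ≤ _ := hlow
  · calc ∫ t in (0 : ℝ)..(N + 1 : ℕ), fiSlice x t ≤ ∑ i ∈ range (N + 1), fiSlice x (i : ℝ) := hup
      _ = ∑ c ∈ Icc 1 N, fiSlice x c + fiSlice x 0 := by
          rw [sum_range_succ', hIcc]; simp

/-- The substitution `t = x^{1/4} u`: `∫₀^{L} √(x - t⁴) dt = κ x^{3/4}` for `L ≥ x^{1/4}`, `x > 0`.
[cite: FriedlanderIwaniecAnnals1998, (3.15) with d = 1] -/
theorem integral_fiSlice {x L : ℝ} (hx : 0 < x) (hL : x ^ (1 / 4 : ℝ) ≤ L) :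
    ∫ t in (0 : ℝ)..L, fiSlice x t = friedlanderIwaniecKappa * x ^ (3 / 4 : ℝ) := by
  set r := x ^ (1 / 4 : ℝ) with hr
  have hr0 : 0 < r := Real.rpow_pos_of_pos hx _
  have hr4 : r ^ 4 = x := by
    rw [hr, ← Real.rpow_natCast, ← Real.rpow_mul hx.le]; norm_num
  have hint : ∀ a b : ℝ, IntervalIntegrable (fiSlice x) MeasureTheory.volume a b := fun a b =>
    (continuous_fiSlice x).intervalIntegrable a b
  rw [← intervalIntegral.integral_add_adjacent_intervals (hint 0 r) (hint r L)]
  -- the tail vanishes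
  have htail : ∫ t in r..L, fiSlice x t = 0 := by
    rw [intervalIntegral.integral_congr (g := fun _ => (0 : ℝ)) ?_, intervalIntegral.integral_zero]
    intro t ht
    rw [Set.uIcc_of_le hL] at ht
    refine fiSlice_eq_zero ?_
    calc x = r ^ 4 := hr4.symm
      _ ≤ t ^ 4 := pow_le_pow_left₀ hr0.le ht.1 4
  rw [htail, add_zero]
  -- the substitution on `[0, r]`
  have hsub : ∀ t : ℝ, fiSlice x t = Real.sqrt x * Real.sqrt (1 - (t / r) ^ 4) := fun t => by
    rw [fiSlice, ← Real.sqrt_mul hx.le]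
    congr 1
    field_simp
    rw [hr4]; ring
  simp_rw [hsub]
  rw [intervalIntegral.integral_const_mul,
    intervalIntegral.integral_comp_div (fun u => Real.sqrt (1 - u ^ 4)) hr0.ne', zero_div,
    div_self hr0.ne']
  rw [friedlanderIwaniecKappa, smul_eq_mul]
  have h34 : Real.sqrt x * r = x ^ (3 / 4 : ℝ) := by
    rw [Real.sqrt_eq_rpow, hr, ← Real.rpow_add hx]; norm_num
  calc Real.sqrt x * (r * ∫ u in (0 : ℝ)..1, Real.sqrt (1 - u ^ 4))
      = (Real.sqrt x * r) * ∫ u in (0 : ℝ)..1, Real.sqrt (1 - u ^ 4) := by ring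
    _ = _ := by rw [h34, mul_comm]

/-- **FI (4.2), pointwise**: `|A(x) - 4 κ x^{3/4}| ≤ 14 √x` for `x ≥ 1`.
[cite: FriedlanderIwaniecAnnals1998, (4.2) = (3.18)] -/
theorem abs_fiCount_sub_le {x : ℝ} (hx : 1 ≤ x) :
    |fiCount x - 4 * friedlanderIwaniecKappa * x ^ (3 / 4 : ℝ)| ≤ 14 * Real.sqrt x := by
  have hx0 : 0 ≤ x := zero_le_one.trans hx
  set N := ⌊x⌋₊ with hN
  -- `A(x) = #fiDisc N - 1`
  have hA : fiCount x = #(fiDisc N) - 1 := by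
    rw [fiCount, ← sum_fiRepCount_add_one]; push_cast; ring
  have h1 := abs_card_fiDisc_sub_sum_le hx0
  rw [sum_Icc_fiSlice] at h1
  obtain ⟨h2, h3⟩ := sum_le_integral_fiSlice x
  have hL : x ^ (1 / 4 : ℝ) ≤ ((⌊x⌋₊ + 1 : ℕ) : ℝ) := by
    have hx1 : x < ((⌊x⌋₊ + 1 : ℕ) : ℝ) := by push_cast; exact Nat.lt_floor_add_one x
    calc x ^ (1 / 4 : ℝ) ≤ x ^ (1 : ℝ) := Real.rpow_le_rpow_of_exponent_le hx (by norm_num)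
      _ = x := Real.rpow_one x
      _ ≤ _ := hx1.le
  rw [integral_fiSlice (zero_lt_one.trans_le hx) hL] at h2 h3
  rw [fiSlice_zero] at h1 h3
  have hs1 : 1 ≤ Real.sqrt x := by rw [← Real.sqrt_one]; exact Real.sqrt_le_sqrt hx
  rw [hA, abs_le]
  constructor <;> nlinarith [abs_le.mp h1]

/-- **FI (4.2) = (3.18)** discharged: `A(x) = 4 κ x^{3/4} + O(x^{1/2})`.
[cite: FriedlanderIwaniecAnnals1998, (4.2) = (3.18)] -/
theorem _root_.Literature.NumberTheory.Sieve.FriedlanderIwaniec1998_count_asymp_holds :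
    FriedlanderIwaniec1998_count_asymp := by
  refine IsBigO.of_bound 14 ?_
  filter_upwards [eventually_ge_atTop (1 : ℝ)] with x hx
  rw [Real.norm_eq_abs, Real.norm_eq_abs, abs_of_nonneg (Real.rpow_nonneg (zero_le_one.trans hx) _),
    ← Real.sqrt_eq_rpow]
  exact abs_fiCount_sub_le hx

end FriedlanderIwaniecPrimes

/-! ### The reduction of Theorem 1 to (4.2) and (4.7)–(4.8) -/

open FriedlanderIwaniecPrimes in
/-- **Friedlander–Iwaniec, Theorem 1, from (4.2) and (4.7)–(4.8)** ("Therefore (4.7), (4.8) and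
(4.2) yield the asymptotic formula (1.1) of our main theorem. Note that in the formulation of
Theorem 1 we restricted to representations by positive integers thus obtaining a constant equal to
one fourth of that in (4.7)", §4, the paragraph following (4.8)): the named fact
`Literature.NumberTheory.Sieve.friedlanderIwaniecSum_isEquivalent` (parity.S17) follows from the lattice-point count
`FriedlanderIwaniec1998_count_asymp` and the prime asymptotic `FriedlanderIwaniec1998_primeSum_asymp`;
the prime powers `p^k`, `k ≥ 2`, and the points on the coordinate axes, not mentioned in print, are
shown to contribute `O(x^{7/12} (log x)²) = o(x^{3/4})`.
[cite: FriedlanderIwaniecAnnals1998, §4, deduction of (1.1) from (4.2), (4.7), (4.8)] -/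
theorem friedlanderIwaniecSum_isEquivalent_of_count_of_primeSum
    (h42 : FriedlanderIwaniec1998_count_asymp) (h47 : FriedlanderIwaniec1998_primeSum_asymp) :
    friedlanderIwaniecSum_isEquivalent := by
  have hP := (isLittleO_fiPrimeSum_sub h42 h47).comp_tendsto tendsto_natCast_atTop_atTop
  have hF := isLittleO_four_mul_sub_fiPrimeSum
  have h4 : (fun x : ℕ => 4 * friedlanderIwaniecSum x -
      16 / Real.pi * friedlanderIwaniecKappa * (x : ℝ) ^ (3 / 4 : ℝ)) =o[atTop]
      fun x : ℕ => (x : ℝ) ^ (3 / 4 : ℝ) := by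
    refine (hF.add hP).congr_left fun x => ?_
    simp only [Function.comp_apply]
    ring
  have h5 : (fun x : ℕ => friedlanderIwaniecSum x -
      4 * Real.pi⁻¹ * friedlanderIwaniecKappa * (x : ℝ) ^ (3 / 4 : ℝ)) =o[atTop]
      fun x : ℕ => (x : ℝ) ^ (3 / 4 : ℝ) := by
    refine (h4.const_mul_left (1 / 4)).congr_left fun x => ?_
    ring
  have hc : 4 * Real.pi⁻¹ * friedlanderIwaniecKappa ≠ 0 := by
    have := friedlanderIwaniecKappa_pos
    have := Real.pi_pos
    positivity
  have h6 : (fun x : ℕ => (x : ℝ) ^ (3 / 4 : ℝ)) =O[atTop]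
      fun x : ℕ => 4 * Real.pi⁻¹ * friedlanderIwaniecKappa * (x : ℝ) ^ (3 / 4 : ℝ) :=
    isBigO_self_const_mul hc _ _
  exact h5.trans_isBigO h6

/-- **Friedlander–Iwaniec, Theorem 1, from (4.7)–(4.8)**: with (4.2) discharged
(`FriedlanderIwaniec1998_count_asymp_holds`), parity.S17 follows from the prime asymptotic
`FriedlanderIwaniec1998_primeSum_asymp` alone (FI Proposition 2.1 + Proposition 3.5 +
Proposition 4.1 + (4.8)).
[cite: FriedlanderIwaniecAnnals1998, §4, deduction of (1.1) from (4.2), (4.7), (4.8)] -/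
theorem friedlanderIwaniecSum_isEquivalent_of_primeSum (h47 : FriedlanderIwaniec1998_primeSum_asymp) :
    friedlanderIwaniecSum_isEquivalent :=
  friedlanderIwaniecSum_isEquivalent_of_count_of_primeSum FriedlanderIwaniec1998_count_asymp_holds h47

/-! # Part II. (4.7) from Propositions 2.1, 3.5, 4.1 and (4.8) -/

/-! ### `ρ(d)` and the density `g` of (3.16) -/

/-- FI's `ρ(d)`: the number of solutions `α (mod d)` of `α² + 1 ≡ 0 (mod d)` (so `ρ(p) = 1 + χ₄(p)`
for odd primes, `ρ(2) = 1`, `ρ(2^α) = 0` for `α ≥ 2`; `ρ(0) = 0`, `ρ(1) = 1`).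
[cite: FriedlanderIwaniecAnnals1998, §3, definition of ρ(b; d) and ρ(d) before (3.2)] -/
def fiRho (d : ℕ) : ℕ := #{α ∈ range d | d ∣ α ^ 2 + 1}

/-- `ρ(1) = 1`. [folklore] -/
theorem fiRho_one : fiRho 1 = 1 := by decide

/-- `ρ(2) = 1`. [folklore] -/
theorem fiRho_two : fiRho 2 = 1 := by decide

/-- `ρ(4) = 0`. [folklore] -/
theorem fiRho_four : fiRho 4 = 0 := by decide

/-- `ρ(5) = 2` (`α = 2, 3`). [folklore] -/
theorem fiRho_five : fiRho 5 = 2 := by decide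

/-- The values of FI's density `g` on prime powers, (3.16):
`g(p) p = 1 + χ₄(p) (1 - 1/p)`, `g(p²) p² = 1 + ρ(p) (1 - 1/p)` except `g(4) = 1/4`.
FI define `g(d)` only for cubefree `d` (the moduli of (2.9)/(3.19)); the value `0` at `p^k`,
`k ≥ 3`, is a documented junk value never used by the statements below (and `g(p⁰) = 1`).
[cite: FriedlanderIwaniecAnnals1998, (3.16)] -/
def fiDensityPrimePow (p k : ℕ) : ℝ :=
  if k = 0 then 1
  else if k = 1 then (1 + (ZMod.χ₄ p : ℝ) * (1 - (p : ℝ)⁻¹)) / p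
  else if k = 2 then (if p = 2 then 1 / 4 else (1 + (fiRho p : ℝ) * (1 - (p : ℝ)⁻¹)) / (p : ℝ) ^ 2)
  else 0

/-- FI's density function `g` of (3.16), extended multiplicatively
(`g(d) = ∏_{p^k ‖ d} g(p^k)`, `g(0) = 0`). [cite: FriedlanderIwaniecAnnals1998, (3.16)] -/
def fiDensity : ArithmeticFunction ℝ :=
  ⟨fun d => if d = 0 then 0 else d.factorization.prod fun p k => fiDensityPrimePow p k, if_pos rfl⟩

/-- Unfolding `fiDensity` at `d ≠ 0`. [cite: FriedlanderIwaniecAnnals1998, (3.16)] -/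
theorem fiDensity_apply {d : ℕ} (hd : d ≠ 0) :
    fiDensity d = d.factorization.prod fun p k => fiDensityPrimePow p k := by
  simp [fiDensity, hd]

/-- `g` is multiplicative ("the multiplicative functions given by (3.16)", Lemma 3.4).
[cite: FriedlanderIwaniecAnnals1998, Lemma 3.4 and (3.16)] -/
theorem isMultiplicative_fiDensity : fiDensity.IsMultiplicative := by
  refine ArithmeticFunction.IsMultiplicative.iff_ne_zero.mpr ⟨by simp [fiDensity], ?_⟩
  intro m n hm hn hmn
  rw [fiDensity_apply hm, fiDensity_apply hn, fiDensity_apply (mul_ne_zero hm hn),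
    Nat.factorization_mul_of_coprime hmn, Finsupp.prod_add_index_of_disjoint]
  simpa [Nat.support_factorization] using hmn.disjoint_primeFactors

/-- `g(p^k)` on a prime power. [cite: FriedlanderIwaniecAnnals1998, (3.16)] -/
theorem fiDensity_prime_pow {p : ℕ} (hp : p.Prime) (k : ℕ) :
    fiDensity (p ^ k) = fiDensityPrimePow p k := by
  rw [fiDensity_apply (pow_ne_zero k hp.ne_zero), hp.factorization_pow,
    Finsupp.prod_single_index]
  simp [fiDensityPrimePow]

/-- `g(p) = (1 + χ₄(p)(1 - 1/p)) / p`. [cite: FriedlanderIwaniecAnnals1998, (3.16)] -/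
theorem fiDensity_prime {p : ℕ} (hp : p.Prime) :
    fiDensity p = (1 + (ZMod.χ₄ p : ℝ) * (1 - (p : ℝ)⁻¹)) / p := by
  simpa [fiDensityPrimePow] using fiDensity_prime_pow hp 1

/-- `g(p²) = (1 + ρ(p)(1 - 1/p)) / p²` for odd primes `p`.
[cite: FriedlanderIwaniecAnnals1998, (3.16)] -/
theorem fiDensity_prime_sq {p : ℕ} (hp : p.Prime) (hp2 : p ≠ 2) :
    fiDensity (p ^ 2) = (1 + (fiRho p : ℝ) * (1 - (p : ℝ)⁻¹)) / (p : ℝ) ^ 2 := by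
  rw [fiDensity_prime_pow hp 2]; simp [fiDensityPrimePow, hp2]

/-- The exceptional value `g(4) = 1/4`. [cite: FriedlanderIwaniecAnnals1998, (3.16)] -/
theorem fiDensity_four : fiDensity 4 = 1 / 4 := by
  rw [show (4 : ℕ) = 2 ^ 2 by norm_num, fiDensity_prime_pow Nat.prime_two 2]
  simp [fiDensityPrimePow]

/-- `g(2) = 1/2` (`χ₄(2) = 0`). [cite: FriedlanderIwaniecAnnals1998, (3.16)] -/
theorem fiDensity_two : fiDensity 2 = 1 / 2 := by
  rw [fiDensity_prime Nat.prime_two]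
  simp

/-- `g(5) = 9/25` (`χ₄(5) = 1`: `g(p) = (2p - 1)/p²` for `p ≡ 1 (mod 4)`). [folklore] -/
theorem fiDensity_five : fiDensity 5 = 9 / 25 := by
  rw [fiDensity_prime (by norm_num)]
  simp; norm_num

/-! #### `ρ(p) = 1 + χ₄(p)` for odd primes -/

/-- `ρ(d)` counted in `ZMod d` (`d ≠ 0`). [folklore] -/
theorem fiRho_eq_card_zmod (d : ℕ) [NeZero d] :
    fiRho d = #{a : ZMod d | a ^ 2 + 1 = 0} := by
  unfold fiRho
  refine Finset.card_bij (fun α _ => (α : ZMod d)) ?_ ?_ ?_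
  · intro α hα
    obtain ⟨-, hdvd⟩ := mem_filter.mp hα
    refine mem_filter.mpr ⟨mem_univ _, ?_⟩
    have h := (ZMod.natCast_eq_zero_iff (α ^ 2 + 1) d).mpr hdvd
    push_cast at h
    exact h
  · intro α hα β hβ h
    have hα' := mem_range.mp (mem_filter.mp hα).1
    have hβ' := mem_range.mp (mem_filter.mp hβ).1
    have h' := (ZMod.natCast_eq_natCast_iff' α β d).mp h
    rwa [Nat.mod_eq_of_lt hα', Nat.mod_eq_of_lt hβ'] at h'
  · intro a ha
    refine ⟨a.val, mem_filter.mpr ⟨mem_range.mpr (ZMod.val_lt a), ?_⟩, ZMod.natCast_zmod_val a⟩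
    have h := (mem_filter.mp ha).2
    refine (ZMod.natCast_eq_zero_iff _ _).mp ?_
    push_cast
    rwa [ZMod.natCast_zmod_val]

/-- In `ZMod p`, `p` an odd prime, `a² + 1 = 0` has two solutions if `p ≡ 1 (mod 4)` and none if
`p ≡ 3 (mod 4)` (Euler's criterion, Mathlib `ZMod.exists_sq_eq_neg_one_iff`). [folklore] -/
theorem card_zmod_sq_add_one_eq {p : ℕ} [Fact p.Prime] (hp2 : p ≠ 2) :
    #{a : ZMod p | a ^ 2 + 1 = 0} = if p % 4 = 1 then 2 else 0 := by
  have hp : p.Prime := Fact.out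
  have hodd : p % 4 = 1 ∨ p % 4 = 3 := by
    rcases hp.eq_two_or_odd' with h | h
    · exact absurd h hp2
    · exact Nat.odd_mod_four_iff.mp (Nat.odd_iff.mp h)
  rcases hodd with h1 | h3
  · rw [if_pos h1]
    obtain ⟨i, hi⟩ := (ZMod.exists_sq_eq_neg_one_iff (p := p)).mpr (by omega)
    have hi2 : i ^ 2 = -1 := by rw [sq]; exact hi.symm
    have h2 : (2 : ZMod p) ≠ 0 := by
      intro h
      have h' : ((2 : ℕ) : ZMod p) = 0 := by exact_mod_cast h
      have hdvd := (ZMod.natCast_eq_zero_iff 2 p).mp h'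
      exact hp2 ((Nat.prime_dvd_prime_iff_eq hp Nat.prime_two).mp hdvd)
    have hne : i ≠ -i := by
      intro h
      have h' : (2 : ZMod p) * i = 0 := by linear_combination h
      rcases mul_eq_zero.mp h' with h'' | h''
      · exact h2 h''
      · rw [h'', mul_zero] at hi
        exact one_ne_zero (neg_eq_zero.mp hi)
    have hset : (univ.filter fun a : ZMod p => a ^ 2 + 1 = 0) = {i, -i} := by
      ext a
      rw [mem_filter, mem_insert, mem_singleton]
      simp only [mem_univ, true_and]
      constructor
      · intro ha
        have ha' : a ^ 2 = i ^ 2 := by rw [hi2]; linear_combination ha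
        exact sq_eq_sq_iff_eq_or_eq_neg.mp ha'
      · rintro (rfl | rfl) <;> linear_combination hi2
    rw [hset, card_pair hne]
  · rw [if_neg (by omega), Finset.card_eq_zero, filter_eq_empty_iff]
    intro a _ ha
    have hsq : IsSquare (-1 : ZMod p) := ⟨a, by linear_combination -ha⟩
    exact (ZMod.exists_sq_eq_neg_one_iff.mp hsq) h3

/-- **`ρ(p^α) = 1 + χ₄(p)`** at `α = 1` for odd primes `p`, as printed (§3).
[cite: FriedlanderIwaniecAnnals1998, §3, display "ρ(p^α) = 1 + χ₄(p)" before (3.2)] -/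
theorem fiRho_prime {p : ℕ} (hp : p.Prime) (hp2 : p ≠ 2) : (fiRho p : ℤ) = 1 + ZMod.χ₄ p := by
  haveI : Fact p.Prime := ⟨hp⟩
  haveI : NeZero p := ⟨hp.ne_zero⟩
  rw [fiRho_eq_card_zmod p, card_zmod_sq_add_one_eq hp2]
  have hodd : p % 4 = 1 ∨ p % 4 = 3 := by
    rcases hp.eq_two_or_odd' with h | h
    · exact absurd h hp2
    · exact Nat.odd_mod_four_iff.mp (Nat.odd_iff.mp h)
  rcases hodd with h1 | h3
  · rw [if_pos h1, ZMod.χ₄_nat_one_mod_four h1]; norm_num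
  · rw [if_neg (by omega), ZMod.χ₄_nat_three_mod_four h3]; norm_num

/-! #### Hypotheses (2.4)–(2.6) for `g` ("easily verified by an examination of (3.16)") -/

/-- The values of `g(p)`, `g(p²)` at an odd prime, by residue class mod `4`:
`p ≡ 1`: `g(p) = (2 - 1/p)/p`, `g(p²) = (3 - 2/p)/p²`; `p ≡ 3`: `g(p) = g(p²) = 1/p²`. [folklore] -/
theorem fiDensity_odd_prime {p : ℕ} (hp : p.Prime) (hp2 : p ≠ 2) :
    (p % 4 = 1 ∧ fiDensity p = (2 - (p : ℝ)⁻¹) / p ∧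
        fiDensity (p ^ 2) = (3 - 2 * (p : ℝ)⁻¹) / (p : ℝ) ^ 2) ∨
      (p % 4 = 3 ∧ fiDensity p = 1 / (p : ℝ) ^ 2 ∧ fiDensity (p ^ 2) = 1 / (p : ℝ) ^ 2) := by
  have hodd : p % 4 = 1 ∨ p % 4 = 3 := by
    rcases hp.eq_two_or_odd' with h | h
    · exact absurd h hp2
    · exact Nat.odd_mod_four_iff.mp (Nat.odd_iff.mp h)
  have hρ := fiRho_prime hp hp2
  have hp0 : (p : ℝ) ≠ 0 := by exact_mod_cast hp.ne_zero
  rw [fiDensity_prime hp, fiDensity_prime_sq hp hp2]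
  rcases hodd with h1 | h3
  · left
    have hχ : ZMod.χ₄ p = 1 := ZMod.χ₄_nat_one_mod_four h1
    rw [hχ] at hρ ⊢
    have hρ' : (fiRho p : ℝ) = 2 := by
      have h : (fiRho p : ℤ) = 2 := by rw [hρ]; norm_num
      exact_mod_cast h
    refine ⟨h1, ?_, ?_⟩
    · push_cast; ring
    · rw [hρ']; ring
  · right
    have hχ : ZMod.χ₄ p = -1 := ZMod.χ₄_nat_three_mod_four h3
    rw [hχ] at hρ ⊢
    have hρ' : (fiRho p : ℝ) = 0 := by
      have h : (fiRho p : ℤ) = 0 := by rw [hρ]; norm_num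
      exact_mod_cast h
    refine ⟨h3, ?_, ?_⟩
    · push_cast; field_simp; ring
    · rw [hρ']; ring

/-- **(2.4) for `g`**: `0 ≤ g(p²) ≤ g(p) < 1` for every prime `p`.
[cite: FriedlanderIwaniecAnnals1998, §3, paragraph after Proposition 3.5, hypothesis (2.4)] -/
theorem fiDensity_hyp24 {p : ℕ} (hp : p.Prime) :
    0 ≤ fiDensity (p ^ 2) ∧ fiDensity (p ^ 2) ≤ fiDensity p ∧ fiDensity p < 1 := by
  by_cases hp2 : p = 2
  · subst hp2
    rw [show (2 : ℕ) ^ 2 = 4 by norm_num, fiDensity_four, fiDensity_two]; norm_num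
  have hp3 : (3 : ℝ) ≤ p := by
    have : 3 ≤ p := by
      rcases hp.eq_two_or_odd' with h | h
      · exact absurd h hp2
      · have := hp.two_le; omega
    exact_mod_cast this
  rcases fiDensity_odd_prime hp hp2 with ⟨-, h1, h2⟩ | ⟨-, h1, h2⟩
  · rw [h1, h2]
    refine ⟨?_, ?_, ?_⟩
    · apply div_nonneg _ (by positivity)
      rw [sub_nonneg]
      calc 2 * (p : ℝ)⁻¹ ≤ 2 * 3⁻¹ := by gcongr
        _ ≤ 3 := by norm_num
    · rw [div_le_div_iff₀ (by positivity) (by positivity)]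
      field_simp
      nlinarith
    · rw [div_lt_one (by positivity)]
      have : 0 < (p : ℝ)⁻¹ := by positivity
      linarith
  · rw [h1, h2]
    refine ⟨by positivity, le_rfl, ?_⟩
    rw [div_lt_one (by positivity)]
    nlinarith

/-- **(2.5)–(2.6) for `g`**: `g(p) ≤ 2/p` and `g(p²) ≤ 3/p²` for every prime `p`.
[cite: FriedlanderIwaniecAnnals1998, §3, paragraph after Proposition 3.5, hypotheses (2.5)-(2.6)] -/
theorem fiDensity_hyp2526 {p : ℕ} (hp : p.Prime) :
    fiDensity p ≤ 2 / p ∧ fiDensity (p ^ 2) ≤ 3 / (p : ℝ) ^ 2 := by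
  by_cases hp2 : p = 2
  · subst hp2
    rw [show (2 : ℕ) ^ 2 = 4 by norm_num, fiDensity_four, fiDensity_two]; norm_num
  have hp3 : (3 : ℝ) ≤ p := by
    have : 3 ≤ p := by
      rcases hp.eq_two_or_odd' with h | h
      · exact absurd h hp2
      · have := hp.two_le; omega
    exact_mod_cast this
  have hi : 0 < (p : ℝ)⁻¹ := by positivity
  rcases fiDensity_odd_prime hp hp2 with ⟨-, h1, h2⟩ | ⟨-, h1, h2⟩
  · rw [h1, h2]
    constructor
    · gcongr; linarith
    · gcongr; linarith
  · rw [h1, h2]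
    constructor
    · rw [div_le_div_iff₀ (by positivity) (by positivity)]
      nlinarith
    · gcongr; norm_num

/-! ### The Friedlander–Iwaniec sifted sequence -/

/-- The sequence `a_n` of (4.1) as a sifted sequence: `a = a_n`, `X(x) = A(x)` itself (FI (2.3):
`A_d(x) = g(d) A(x) + r_d(x)`), density `g` of (3.16).
[cite: FriedlanderIwaniecAnnals1998, (2.3), (3.16)-(3.17), (4.1)-(4.2)] -/
def fiSieveSeq : SieveSequence where
  a n := fiRepCount n
  a_nonneg _ := Nat.cast_nonneg _
  size := fiCount
  density := fiDensity
  density_mult := isMultiplicative_fiDensity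

/-- `fiSieveSeq.size = A(x)` is the counting function: `A(x) = A_1(x)`.
[cite: FriedlanderIwaniecAnnals1998, (4.2)] -/
theorem fiSieveSeq_size_eq (x : ℝ) : fiSieveSeq.size x = fiSieveSeq.congrSum 1 x := by
  simp only [fiSieveSeq, SieveSequence.congrSum, fiCount,
    Finset.filter_true_of_mem fun n _ => one_dvd n]
  refine Finset.sum_congr ?_ fun _ _ => rfl
  ext n; simp [Nat.one_le_iff_ne_zero, Nat.pos_iff_ne_zero]

/-- `fiSieveSeq.remainder d t = r_d(t) = A_d(t) - g(d) A(t)` (3.17).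
[cite: FriedlanderIwaniecAnnals1998, (3.17)] -/
theorem fiSieveSeq_remainder (d : ℕ) (t : ℝ) :
    fiSieveSeq.remainder d t = fiSieveSeq.congrSum d t - fiDensity d * fiCount t := rfl

end Literature.NumberTheory.Sieve

namespace Literature.NumberTheory.Sieve

/-! ### Cubefree moduli -/

/-- `d` is cubefree: no prime cube divides it (every exponent in the factorisation is `≤ 2`;
`0` counts as cubefree vacuously but never occurs as a modulus below). [folklore] -/
def IsCubefree (d : ℕ) : Prop := ∀ p ∈ d.primeFactors, d.factorization p ≤ 2

/-- Cubefreeness is decidable (a bounded quantifier over the prime factors). [folklore] -/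
instance : DecidablePred IsCubefree := fun d => by unfold IsCubefree; infer_instance

/-- Squarefree numbers are cubefree. [folklore] -/
theorem IsCubefree.of_squarefree {d : ℕ} (hd : Squarefree d) : IsCubefree d :=
  fun p _ => (hd.natFactorization_le_one p).trans one_le_two

namespace SieveSequence

/-! ### The bilinear form (2.11)/(4.3) with the sieving parameter `P` -/

/-- The bilinear form of FI (2.11) = (4.3) for a sifted sequence `A = (a_n)`:
`B(x; N) = ∑_m |∑_{N < n ≤ 2N, mn ≤ x, (n, mΠ) = 1} β(n, C) a_{mn}|` with
`β(n, C) = μ(n) ∑_{c ∣ n, c ≤ C} μ(c) = μ(n) γ(n, C)` (2.12) and `Π` the product of the primes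
`p < P` ((2.15); §4 prints "p ≤ P" at (4.3)), so that `(n, Π) = 1` says that every prime factor of
`n` is `≥ P`. The outer sum is over all `m ≥ 1`; `mn ≤ x` forces `m ≤ x`.
[cite: FriedlanderIwaniecAnnals1998, (2.11)-(2.12) and (4.3)] -/
def fiBilinearPi (A : SieveSequence) (x N C P : ℝ) : ℝ :=
  ∑ m ∈ Icc 1 ⌊x⌋₊,
    |∑ n ∈ (Ioc ⌊N⌋₊ ⌊2 * N⌋₊).filter
        (fun n : ℕ => ((m * n : ℕ) : ℝ) ≤ x ∧ n.Coprime m ∧ ∀ p ∈ n.primeFactors, P ≤ (p : ℝ)),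
      (μ n : ℝ) * (fiGamma C n : ℝ) * A.a (m * n)|

/-- `fiBilinearPi` unfolded. [cite: FriedlanderIwaniecAnnals1998, (2.11)-(2.12)] -/
theorem fiBilinearPi_def (A : SieveSequence) (x N C P : ℝ) :
    A.fiBilinearPi x N C P = ∑ m ∈ Icc 1 ⌊x⌋₊,
      |∑ n ∈ (Ioc ⌊N⌋₊ ⌊2 * N⌋₊).filter
          (fun n : ℕ => ((m * n : ℕ) : ℝ) ≤ x ∧ n.Coprime m ∧ ∀ p ∈ n.primeFactors, P ≤ (p : ℝ)),
        (μ n : ℝ) * (fiGamma C n : ℝ) * A.a (m * n)| := rfl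

/-- The bilinear form is a sum of absolute values, hence nonnegative. [folklore] -/
theorem fiBilinearPi_nonneg (A : SieveSequence) (x N C P : ℝ) : 0 ≤ A.fiBilinearPi x N C P :=
  Finset.sum_nonneg fun _ _ => abs_nonneg _

/-- **The hypotheses (2.1)–(2.15) of FI's Proposition 2.1** (the asymptotic sieve for primes in the
form used for `X² + Y⁴`: sequences supported on all integers, cubefree level hypothesis, bilinear
forms with the sieving parameter `P`) for a sifted sequence `A = (a_n)_{n ≥ 1}`, `a_n ≥ 0`, with
multiplicative density `g = A.density`, level function `D = D(x)`, bilinear-range parameters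
`δ = δ(x) ≤ Δ = Δ(x)` and sieving parameter `P = P(x)`; writing `A(x) = ∑_{n ≤ x} a_n`,
`A_d(x) = ∑_{n ≤ x, d ∣ n} a_n = g(d) A(x) + r_d(x)` (2.3), `L = (log x)^{2^{24}}`:
* `size_eq`: the bundled `A.size` is `A(x)` (so `A.remainder d = r_d`);
* (2.1) `A(x) ≫ A(√x) (log x)²`;  (2.2) `A(x) ≫ x^{1/3} (∑_{n ≤ x} a_n²)^{1/2}`;
* (2.4) `0 ≤ g(p²) ≤ g(p) < 1`;  (2.5) `g(p) ≪ p⁻¹`;  (2.6) `g(p²) ≪ p⁻²` (all primes `p`);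
* (2.7) `∑_{p ≤ y} g(p) = log log y + c + O((log y)^{-10})` for all `y ≥ 2`;
* (2.8) `A_d(x) ≪ d⁻¹ τ(d)⁸ A(x)` uniformly in `d ≤ x^{1/3}`;
* (2.9) `∑_{d ≤ D L², d cubefree} |r_d(t)| ≤ A(x) L⁻²` uniformly in `t ≤ x`, with (2.10)
  `x^{2/3} < D < x`;
* (2.11) `B(x; N) ≤ A(x) (log x)^{-2^{26}}` (`SieveSequence.fiBilinearPi`, coefficients (2.12)) for
  every `C` with (2.13) `1 ≤ C ≤ x D⁻¹` and every `N` with (2.14) `Δ⁻¹ √D < N < δ⁻¹ √x`, where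
  `Δ ≥ δ ≥ 2`, for the chosen `P` subject to (2.15) `2 ≤ P ≤ Δ^{1/(2^{35} log log x)}`;
the `x`-local conditions being required for all sufficiently large `x` ("Let `x` be a given
number, sufficiently large in terms of `𝒜`"). Implied constants are existentially quantified.
[cite: FriedlanderIwaniecAnnals1998, §2, (2.1)-(2.15)] -/
def FI1998SieveHypotheses (A : SieveSequence) (D δ Δ P : ℝ → ℝ) : Prop :=
  -- `A.size` is the counting function `A(x) = ∑_{n ≤ x} a_n`
  (∀ x, A.size x = A.congrSum 1 x) ∧
  -- (2.1)
  (∃ c : ℝ, 0 < c ∧ ∀ᶠ x : ℝ in atTop, c * A.size (Real.sqrt x) * Real.log x ^ 2 ≤ A.size x) ∧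
  -- (2.2)
  (∃ c : ℝ, 0 < c ∧ ∀ᶠ x : ℝ in atTop,
    c * x ^ (1 / 3 : ℝ) * Real.sqrt (∑ n ∈ Icc 1 ⌊x⌋₊, A.a n ^ 2) ≤ A.size x) ∧
  -- (2.4)
  (∀ p : ℕ, p.Prime → 0 ≤ A.density (p ^ 2) ∧ A.density (p ^ 2) ≤ A.density p ∧ A.density p < 1) ∧
  -- (2.5), (2.6)
  (∃ K : ℝ, ∀ p : ℕ, p.Prime → A.density p ≤ K / p ∧ A.density (p ^ 2) ≤ K / (p : ℝ) ^ 2) ∧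
  -- (2.7)
  (∃ c K : ℝ, ∀ y : ℝ, 2 ≤ y →
    |(∑ p ∈ Nat.primesLE ⌊y⌋₊, A.density p) - (Real.log (Real.log y) + c)| ≤
      K / Real.log y ^ 10) ∧
  -- (2.8)
  (∃ K : ℝ, ∀ᶠ x : ℝ in atTop, ∀ d : ℕ, 1 ≤ d → (d : ℝ) ≤ x ^ (1 / 3 : ℝ) →
    A.congrSum d x ≤ K * (ArithmeticFunction.sigma 0 d : ℝ) ^ 8 / d * A.size x) ∧
  -- (2.10), `Δ ≥ δ ≥ 2`, (2.15)
  (∀ᶠ x : ℝ in atTop, x ^ (2 / 3 : ℝ) < D x ∧ D x < x ∧ 2 ≤ δ x ∧ δ x ≤ Δ x ∧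
    2 ≤ P x ∧ P x ≤ Δ x ^ (1 / (2 ^ 35 * Real.log (Real.log x)))) ∧
  -- (2.9) with `L = (log x)^(2^24)`
  (∀ᶠ x : ℝ in atTop, ∀ t : ℝ, t ≤ x →
    ∑ d ∈ (Icc 1 ⌊D x * (Real.log x ^ (2 ^ 24 : ℕ)) ^ 2⌋₊).filter IsCubefree,
        |A.remainder d t| ≤ A.size x / (Real.log x ^ (2 ^ 24 : ℕ)) ^ 2) ∧
  -- (2.11) in the ranges (2.13), (2.14)
  (∀ᶠ x : ℝ in atTop, ∀ C : ℝ, 1 ≤ C → C ≤ x / D x →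
    ∀ N : ℝ, Real.sqrt (D x) / Δ x < N → N < Real.sqrt x / δ x →
      A.fiBilinearPi x N C (P x) ≤ A.size x / Real.log x ^ (2 ^ 26 : ℕ))

end SieveSequence

end Literature.NumberTheory.Sieve

namespace Literature.NumberTheory.Sieve

/-! ### Proposition 2.1 (named fact, in its working regime) -/

/-- **FI Proposition 2.1** (the asymptotic sieve for primes of [FriedlanderIwaniecASP1998] "in a
form which is suitable for the proof of the main theorem"), in the regime in which it is used.
As printed: assuming (2.1)–(2.15) (`SieveSequence.FI1998SieveHypotheses`),
(2.16) `S(x) = ∑_{p ≤ x} a_p log p = H A(x) {1 + O(log δ / log Δ)}` where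
(2.17) `H = ∏_p (1 - g(p))(1 - 1/p)⁻¹` (a convergent product; `SieveSequence.HasDensityConstant`)
"and the implied constant depends only on the function `g`"; "In practice `δ` is a large power of
`log x` and `Δ` is a small power of `x`."  Read literally over all parameter functions
`Δ ≥ δ ≥ 2` the display is not a correct theorem (a vacuous (2.14) with tiny `log δ / log Δ`; see
the discussion of `Literature.NumberTheory.Sieve.fi_asymptotic_sieve_primes` in `AsymptoticSieveForPrimes`), so, exactly as
for `Literature.NumberTheory.Sieve.fi_asymptotic_sieve_primes_loglog`, the fact is vendored in the working regime
`δ = (log x)^α`, `Δ = x^θ` (`α > 0`, `0 < θ < 1/3`, so that `√D / Δ > x^{1/3 - θ} → ∞`), where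
`log δ / log Δ = (α/θ) log log x / log x`; this is the case applied in §4 to obtain (4.7)
(`D = x^{3/4 - 5ε}`, `x^{3/8 - η} < N < x^{1/2} (log x)^{-B}`). The `IsBigO` constant may depend on
everything fixed (implied by, never stronger than, the printed uniformity in `g`).
[cite: FriedlanderIwaniecAnnals1998, Proposition 2.1, (2.16)-(2.17)] -/
def FriedlanderIwaniec1998_prop21 : Prop :=
  ∀ (A : SieveSequence) (D P : ℝ → ℝ) (α θ H : ℝ), 0 < α → 0 < θ → θ < 1 / 3 →
    A.FI1998SieveHypotheses D (fun x => Real.log x ^ α) (fun x => x ^ θ) P →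
      A.HasDensityConstant H →
      (fun x : ℝ => (∑ p ∈ Nat.primesLE ⌊x⌋₊, A.a p * Real.log p) - H * A.size x) =O[atTop]
        fun x : ℝ => H * A.size x * (Real.log (Real.log x) / Real.log x)

/-! ### Proposition 3.5, Proposition 4.1 and (4.8) for the sequence `a_n` (named facts) -/

/-- **FI Proposition 3.5** (level of distribution of `a_n` for cubefree moduli): for every `ε > 0`,
every `D ≥ 1` and all `t ≤ x`,
(3.19) `∑_{d ≤ D, d cubefree} |r_d(t)| ≪ D^{1/4} x^{9/16 + ε}`,
`r_d(t) = A_d(t) - g(d) A(t)` (3.17) with `g` from (3.16), the implied constant depending only on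
`ε` (from Lemma 3.1, "for any `D ≥ 1` and `ε > 0`, the implied constant depending only on `ε`", and
Lemma 3.4). It verifies (2.9) with `D = x^{3/4 - 5ε}`. "Let `x` be a given number, sufficiently
large" (§2): the bound is demanded for all sufficiently large `x` (`∀ᶠ x in atTop`).
[cite: FriedlanderIwaniecAnnals1998, Proposition 3.5, (3.19)] -/
def FriedlanderIwaniec1998_prop35 : Prop :=
  ∀ ε : ℝ, 0 < ε → ∃ K : ℝ, ∀ᶠ x : ℝ in atTop, ∀ D : ℝ, 1 ≤ D → ∀ t : ℝ, t ≤ x →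
    ∑ d ∈ (Icc 1 ⌊D⌋₊).filter IsCubefree, |fiSieveSeq.remainder d t| ≤
      K * D ^ (1 / 4 : ℝ) * x ^ (9 / 16 + ε : ℝ)

/-- **FI Proposition 4.1** (the bilinear form bound, "the heart of the problem", §§4–26): let
`η > 0` and `A > 0`. Then
(4.5) `B(x; N) ≪ A(x) (log x)^{4 - A}`
for every `N` with (4.6) `x^{1/4 + η} < N < x^{1/2} (log x)^{-B}` and the coefficients `β(n, C)` of
(2.12) with `1 ≤ C ≤ N^{1 - η}`, where `B(x; N)` is (4.3) with `Π` the product of the primes below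
`P`, `P` in the range (4.4) `(log log x)² ≤ log P ≤ (log x)(log log x)⁻²`; "`B` and the implied
constant in (4.5) need to be taken sufficiently large in terms of `η` and `A`", `x` large.
[cite: FriedlanderIwaniecAnnals1998, Proposition 4.1, (4.3)-(4.6)] -/
def FriedlanderIwaniec1998_prop41 : Prop :=
  ∀ η : ℝ, 0 < η → ∀ A : ℝ, 0 < A → ∃ B : ℝ, 0 < B ∧ ∃ K : ℝ, ∀ᶠ x : ℝ in atTop,
    ∀ P : ℝ, Real.log (Real.log x) ^ 2 ≤ Real.log P →
      Real.log P ≤ Real.log x * (Real.log (Real.log x))⁻¹ ^ 2 →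
    ∀ N : ℝ, x ^ (1 / 4 + η : ℝ) < N → N < x ^ (1 / 2 : ℝ) / Real.log x ^ B →
    ∀ C : ℝ, 1 ≤ C → C ≤ N ^ (1 - η : ℝ) →
      fiSieveSeq.fiBilinearPi x N C P ≤ K * fiCount x * Real.log x ^ (4 - A : ℝ)

/-- **FI (4.8)**: for the density (3.16), `g(p) p = 1 + χ₄(p)(1 - 1/p)`, the constant (2.17) is
`H = ∏_p (1 - g(p))(1 - 1/p)⁻¹ = ∏_p (1 - χ₄(p) p⁻¹) = L(1, χ₄)⁻¹ = 4/π` (the Euler product at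
`s = 1` taken in increasing order of `p`; `SieveSequence.HasDensityConstant`).
[cite: FriedlanderIwaniecAnnals1998, (4.8)] -/
def FriedlanderIwaniec1998_densityConstant : Prop :=
  fiSieveSeq.HasDensityConstant (4 / Real.pi)

/-- The factor of (4.8) at a prime: `1 - g(p) = (1 - 1/p)(1 - χ₄(p)/p)`.
[cite: FriedlanderIwaniecAnnals1998, (4.8)] -/
theorem one_sub_fiDensity_prime {p : ℕ} (hp : p.Prime) :
    1 - fiDensity p = (1 - (p : ℝ)⁻¹) * (1 - (ZMod.χ₄ p : ℝ) * (p : ℝ)⁻¹) := by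
  rw [fiDensity_prime hp]
  have hp0 : (p : ℝ) ≠ 0 := by exact_mod_cast hp.ne_zero
  field_simp
  ring

/-! ### The remaining hypotheses of Proposition 2.1 for `a_n` asserted in §3 (named facts) -/

/-- **(2.2) for `a_n`** ("the crude bounds (2.1), (2.2) and (2.8) are obvious in our case", §3 after
Prop. 3.5; no proof is printed): `A(x) ≫ x^{1/3} (∑_{n ≤ x} a_n²)^{1/2}` for `x` large.
((2.1) follows from (4.2) and is not vendored as a fact.)
[cite: FriedlanderIwaniecAnnals1998, §3, paragraph after Proposition 3.5, hypothesis (2.2)] -/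
def FriedlanderIwaniec1998_hyp22 : Prop :=
  ∃ c : ℝ, 0 < c ∧ ∀ᶠ x : ℝ in atTop,
    c * x ^ (1 / 3 : ℝ) * Real.sqrt (∑ n ∈ Icc 1 ⌊x⌋₊, (fiRepCount n : ℝ) ^ 2) ≤ fiCount x

/-- **(2.7) for the density (3.16)** ("The asymptotic formula (2.7) is derived from the Prime Number
Theorem for the primes in residue classes modulo four", §3 after Prop. 3.5): there are constants
`c, K` with `|∑_{p ≤ y} g(p) - (log log y + c)| ≤ K (log y)^{-10}` for all `y ≥ 2`
(Mertens' theorem for `1/p` and for `χ₄(p)/p` with a prime-number-theorem error term).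
[cite: FriedlanderIwaniecAnnals1998, §3, paragraph after Proposition 3.5, hypothesis (2.7)] -/
def FriedlanderIwaniec1998_hyp27 : Prop :=
  ∃ c K : ℝ, ∀ y : ℝ, 2 ≤ y →
    |(∑ p ∈ Nat.primesLE ⌊y⌋₊, fiDensity p) - (Real.log (Real.log y) + c)| ≤ K / Real.log y ^ 10

/-- **(2.8) for `a_n`** ("obvious in our case. More precisely, one can derive by elementary
arguments that `A_d(x) ≪ d⁻¹ τ(d) A(x)` uniformly for `d ≤ x^{1/2 - ε}` in place of (2.8)", §3
after Prop. 3.5; no proof is printed): vendored in the form (2.8) consumed by Proposition 2.1,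
`A_d(x) ≪ d⁻¹ τ(d)⁸ A(x)` uniformly in `1 ≤ d ≤ x^{1/3}`, `x` large.
[cite: FriedlanderIwaniecAnnals1998, §3, paragraph after Proposition 3.5, hypothesis (2.8)] -/
def FriedlanderIwaniec1998_hyp28 : Prop :=
  ∃ K : ℝ, ∀ᶠ x : ℝ in atTop, ∀ d : ℕ, 1 ≤ d → (d : ℝ) ≤ x ^ (1 / 3 : ℝ) →
    fiSieveSeq.congrSum d x ≤ K * (ArithmeticFunction.sigma 0 d : ℝ) ^ 8 / d * fiCount x

namespace FriedlanderIwaniecPrimes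

/-! ### Assembly of (4.7): Proposition 2.1 applied to `a_n`

"By virtue of the results presented in the previous sections Proposition 4.1 is more than
sufficient to infer the formula (4.7) ... (it suffices to have (4.5) with `A = 2^{26} + 4` and
`x^{3/8-η} < N < x^{1/2} (log x)^{-B}` for some `η > 0` and `B > 0`)" (§4). Choices made here:
`ε = θ = 1/200`, `D = x^{3/4 - 5ε}` (§3: "(2.9) with `D = x^{3/4-5ε}`"), `Δ = x^θ`,
`P = exp((log log x)²)` (the bottom of (4.4)), `η = 1/16` and `A = 2^{26} + 5` in Proposition 4.1,
and then `δ = (log x)^B` with the `B` it provides; (2.1) comes from (4.2), (2.9) from Proposition 3.5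
and `A(x) ≥ 2κ x^{3/4}`, (2.11) from Proposition 4.1 and `log x ≥ K`. -/

/-- The exponent `ε = θ = 1/200` used for `D = x^{3/4 - 5ε}` and `Δ = x^θ`. [folklore] -/
def fiEps : ℝ := 1 / 200

/-- The level `D(x) = x^{3/4 - 5ε}` ("(2.9) with `D = x^{3/4-5ε}`", §3 after Prop. 3.5).
[cite: FriedlanderIwaniecAnnals1998, §3, paragraph after Proposition 3.5] -/
def fiLevel (x : ℝ) : ℝ := x ^ (3 / 4 - 5 * fiEps : ℝ)

/-- The sieving parameter `P(x) = exp((log log x)²)` (the bottom of the range (4.4)).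
[cite: FriedlanderIwaniecAnnals1998, (4.4)] -/
def fiP (x : ℝ) : ℝ := Real.exp (Real.log (Real.log x) ^ 2)

/-- From (4.2): `A(x) ≥ 2 κ x^{3/4}` and `A(x) ≤ 6 κ x^{3/4}` eventually. [folklore] -/
theorem fiCount_bounds (h42 : FriedlanderIwaniec1998_count_asymp) :
    ∀ᶠ x : ℝ in atTop, 2 * friedlanderIwaniecKappa * x ^ (3 / 4 : ℝ) ≤ fiCount x ∧
      fiCount x ≤ 6 * friedlanderIwaniecKappa * x ^ (3 / 4 : ℝ) := by
  obtain ⟨C, hC⟩ := h42.bound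
  have hκ := friedlanderIwaniecKappa_pos
  have hev : ∀ᶠ x : ℝ in atTop,
      C * x ^ (1 / 2 : ℝ) ≤ 2 * friedlanderIwaniecKappa * x ^ (3 / 4 : ℝ) := by
    have ht : Tendsto (fun x : ℝ => x ^ (1 / 4 : ℝ)) atTop atTop := tendsto_rpow_atTop (by norm_num)
    filter_upwards [ht.eventually_ge_atTop (C / (2 * friedlanderIwaniecKappa)), eventually_gt_atTop 0]
      with x hx hx0
    have h1 : C ≤ 2 * friedlanderIwaniecKappa * x ^ (1 / 4 : ℝ) := by
      rw [div_le_iff₀ (by positivity)] at hx; linarith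
    have h2 : (0 : ℝ) ≤ x ^ (1 / 2 : ℝ) := by positivity
    calc C * x ^ (1 / 2 : ℝ) ≤ (2 * friedlanderIwaniecKappa * x ^ (1 / 4 : ℝ)) * x ^ (1 / 2 : ℝ) :=
          mul_le_mul_of_nonneg_right h1 h2
      _ = 2 * friedlanderIwaniecKappa * x ^ (3 / 4 : ℝ) := by
          rw [mul_assoc, ← Real.rpow_add hx0]; norm_num
  filter_upwards [hC, hev, eventually_gt_atTop 0] with x h1 h2 hx0
  rw [Real.norm_eq_abs, Real.norm_eq_abs, abs_of_nonneg (by positivity : (0 : ℝ) ≤ x ^ (1 / 2 : ℝ))]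
    at h1
  obtain ⟨h1a, h1b⟩ := abs_le.mp h1
  constructor <;> linarith

/-- (2.1) for `a_n` from (4.2). [folklore] -/
theorem hyp21_of_count (h42 : FriedlanderIwaniec1998_count_asymp) :
    ∃ c : ℝ, 0 < c ∧ ∀ᶠ x : ℝ in atTop,
      c * fiSieveSeq.size (Real.sqrt x) * Real.log x ^ 2 ≤ fiSieveSeq.size x := by
  refine ⟨1, one_pos, ?_⟩
  have hκ := friedlanderIwaniecKappa_pos
  have hb := fiCount_bounds h42
  have hb' := (tendsto_rpow_atTop (by norm_num : (0 : ℝ) < 1 / 2)).eventually hb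
  have hlog : ∀ᶠ x : ℝ in atTop, ‖Real.log x ^ 2‖ ≤ 1 / 3 * ‖x ^ (3 / 8 : ℝ)‖ := by
    refine ((isLittleO_log_rpow_rpow_atTop (s := 3 / 8) 2 (by norm_num)).congr_left
      fun x => ?_).def (by norm_num)
    exact Real.rpow_two _
  filter_upwards [hb, hb', hlog, eventually_gt_atTop 0] with x h1 h2 h3 hx0
  change 1 * fiCount (Real.sqrt x) * Real.log x ^ 2 ≤ fiCount x
  rw [Real.norm_eq_abs, Real.norm_eq_abs, abs_of_nonneg (by positivity),
    abs_of_nonneg (by positivity)] at h3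
  have hs : (x ^ (1 / 2 : ℝ)) ^ (3 / 4 : ℝ) = x ^ (3 / 8 : ℝ) := by
    rw [← Real.rpow_mul hx0.le]; norm_num
  rw [Real.sqrt_eq_rpow]
  simp only [hs] at h2
  have hx34 : x ^ (3 / 4 : ℝ) = x ^ (3 / 8 : ℝ) * x ^ (3 / 8 : ℝ) := by
    rw [← Real.rpow_add hx0]; norm_num
  have h38 : (0 : ℝ) ≤ x ^ (3 / 8 : ℝ) := by positivity
  have hA : 0 ≤ fiCount (x ^ (1 / 2 : ℝ)) := by linarith [h2.1, h38]
  calc 1 * fiCount (x ^ (1 / 2 : ℝ)) * Real.log x ^ 2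
      ≤ (6 * friedlanderIwaniecKappa * x ^ (3 / 8 : ℝ)) * (1 / 3 * x ^ (3 / 8 : ℝ)) := by
        rw [one_mul]
        exact mul_le_mul h2.2 h3 (by positivity) (by positivity)
    _ = 2 * friedlanderIwaniecKappa * x ^ (3 / 4 : ℝ) := by rw [hx34]; ring
    _ ≤ fiCount x := h1.1

/-- The parameter ranges (2.10), `Δ ≥ δ ≥ 2`, (2.15) for the chosen `D, δ, Δ, P`. [folklore] -/
theorem ranges_eventually {α : ℝ} (hα : 0 < α) :
    ∀ᶠ x : ℝ in atTop, x ^ (2 / 3 : ℝ) < fiLevel x ∧ fiLevel x < x ∧ 2 ≤ Real.log x ^ α ∧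
      Real.log x ^ α ≤ x ^ fiEps ∧ 2 ≤ fiP x ∧
      fiP x ≤ (x ^ fiEps) ^ (1 / (2 ^ 35 * Real.log (Real.log x))) := by
  -- `(log x)^α → ∞`
  have hδ : Tendsto (fun x : ℝ => Real.log x ^ α) atTop atTop :=
    (tendsto_rpow_atTop hα).comp Real.tendsto_log_atTop
  -- `(log x)^α ≤ x^ε` eventually
  have hδΔ : ∀ᶠ x : ℝ in atTop, ‖Real.log x ^ α‖ ≤ 1 * ‖x ^ fiEps‖ :=
    (isLittleO_log_rpow_rpow_atTop α (by norm_num [fiEps])).def one_pos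
  -- `log log x → ∞`
  have hll : Tendsto (fun x : ℝ => Real.log (Real.log x)) atTop atTop :=
    Real.tendsto_log_atTop.comp Real.tendsto_log_atTop
  -- `(log log x)^3 ≤ (ε / 2^35) log x` eventually
  have hP : ∀ᶠ x : ℝ in atTop, ‖Real.log (Real.log x) ^ 3‖ ≤ fiEps / 2 ^ 35 * ‖Real.log x‖ := by
    have h := (Real.isLittleO_pow_log_id_atTop (n := 3)).comp_tendsto Real.tendsto_log_atTop
    exact h.def (by norm_num [fiEps])
  filter_upwards [eventually_gt_atTop 1, hδ.eventually_ge_atTop 2, hδΔ, hll.eventually_ge_atTop 1, hP]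
    with x hx1 h2 h3 h4 h5
  have hx0 : 0 < x := zero_lt_one.trans hx1
  have hlog0 : 0 < Real.log x := Real.log_pos hx1
  have hll0 : 0 < Real.log (Real.log x) := zero_lt_one.trans_le h4
  refine ⟨?_, ?_, h2, ?_, ?_, ?_⟩
  · exact Real.rpow_lt_rpow_of_exponent_lt hx1 (by norm_num [fiEps])
  · calc fiLevel x < x ^ (1 : ℝ) := Real.rpow_lt_rpow_of_exponent_lt hx1 (by norm_num [fiEps])
      _ = x := Real.rpow_one x
  · rw [Real.norm_eq_abs, Real.norm_eq_abs, abs_of_nonneg (by positivity),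
      abs_of_nonneg (by positivity), one_mul] at h3
    exact h3
  · -- `2 = exp (log 2) ≤ exp ((log log x)^2)` since `log 2 < 1 ≤ (log log x)^2`
    rw [fiP, ← Real.exp_log two_pos]
    refine Real.exp_le_exp.mpr ?_
    have : Real.log 2 < 1 := by linarith [Real.log_two_lt_d9]
    nlinarith
  · rw [fiP, Real.rpow_def_of_pos (Real.rpow_pos_of_pos hx0 _), Real.log_rpow hx0]
    refine Real.exp_le_exp.mpr ?_
    rw [Real.norm_eq_abs, Real.norm_eq_abs, abs_of_nonneg (by positivity), abs_of_pos hlog0] at h5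
    rw [show fiEps * Real.log x * (1 / (2 ^ 35 * Real.log (Real.log x))) =
      (fiEps / 2 ^ 35 * Real.log x) / Real.log (Real.log x) by field_simp]
    rw [le_div_iff₀ hll0]
    calc Real.log (Real.log x) ^ 2 * Real.log (Real.log x) = Real.log (Real.log x) ^ 3 := by ring
      _ ≤ fiEps / 2 ^ 35 * Real.log x := h5

/-- (2.9) from Proposition 3.5 and (4.2). [folklore] -/
theorem hyp29_of_prop35 (h35 : FriedlanderIwaniec1998_prop35)
    (h42 : FriedlanderIwaniec1998_count_asymp) :
    ∀ᶠ x : ℝ in atTop, ∀ t : ℝ, t ≤ x →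
      ∑ d ∈ (Icc 1 ⌊fiLevel x * (Real.log x ^ (2 ^ 24 : ℕ)) ^ 2⌋₊).filter IsCubefree,
        |fiSieveSeq.remainder d t| ≤ fiSieveSeq.size x / (Real.log x ^ (2 ^ 24 : ℕ)) ^ 2 := by
  obtain ⟨K, hK⟩ := h35 fiEps (by norm_num [fiEps])
  set K₁ : ℝ := max K 1 with hK₁
  have hK₁0 : 0 < K₁ := zero_lt_one.trans_le (le_max_right K 1)
  have hκ := friedlanderIwaniecKappa_pos
  have hb := fiCount_bounds h42
  have hl : ∀ᶠ x : ℝ in atTop, ‖Real.log x ^ (5 * 2 ^ 23 : ℕ)‖ ≤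
      2 * friedlanderIwaniecKappa / K₁ * ‖x ^ (1 / 800 : ℝ)‖ := by
    refine ((isLittleO_log_rpow_rpow_atTop (s := 1 / 800) ((5 * 2 ^ 23 : ℕ) : ℝ)
      (by norm_num)).congr_left fun x => ?_).def (by positivity)
    exact Real.rpow_natCast _ _
  filter_upwards [eventually_ge_atTop 3, hb, hl, hK] with x hx3 hAx hl hKx
  intro t ht
  have hx0 : 0 < x := by linarith
  have hx1 : 1 < x := by linarith
  have hlog1 : 1 ≤ Real.log x := by
    rw [Real.le_log_iff_exp_le hx0]
    linarith [Real.exp_one_lt_d9]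
  have hlog0 : 0 < Real.log x := by linarith
  set L : ℝ := Real.log x ^ (2 ^ 24 : ℕ) with hL
  have hL1 : 1 ≤ L := one_le_pow₀ hlog1
  set D : ℝ := fiLevel x * L ^ 2 with hD
  have hlev1 : 1 ≤ fiLevel x := Real.one_le_rpow hx1.le (by norm_num [fiEps])
  have hD1 : 1 ≤ D := one_le_mul_of_one_le_of_one_le hlev1 (one_le_pow₀ hL1)
  refine (hKx D hD1 t ht).trans ?_
  have hKK : K * D ^ (1 / 4 : ℝ) * x ^ (9 / 16 + fiEps : ℝ) ≤
      K₁ * D ^ (1 / 4 : ℝ) * x ^ (9 / 16 + fiEps : ℝ) :=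
    mul_le_mul_of_nonneg_right (mul_le_mul_of_nonneg_right (le_max_left K 1) (by positivity))
      (by positivity)
  refine hKK.trans ?_
  -- `D^{1/4} = x^{(3/4 - 5ε)/4} (log x)^{2^23}`
  have hD4 : D ^ (1 / 4 : ℝ) = x ^ ((3 / 4 - 5 * fiEps) / 4 : ℝ) * Real.log x ^ (2 ^ 23 : ℕ) := by
    rw [hD, Real.mul_rpow (by positivity) (by positivity), fiLevel, ← Real.rpow_mul hx0.le]
    congr 1
    · norm_num [fiEps]
    · rw [hL, ← pow_mul, ← Real.rpow_natCast _ (2 ^ 24 * 2), ← Real.rpow_mul hlog0.le,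
        ← Real.rpow_natCast]
      norm_num
  have hpow : Real.log x ^ (2 ^ 23 : ℕ) * L ^ 2 = Real.log x ^ (5 * 2 ^ 23 : ℕ) := by
    rw [hL, ← pow_mul, ← pow_add]; norm_num
  have hexp : x ^ ((3 / 4 - 5 * fiEps) / 4 : ℝ) * x ^ (9 / 16 + fiEps : ℝ) =
      x ^ (3 / 4 - 1 / 800 : ℝ) := by
    rw [← Real.rpow_add hx0]; try norm_num [fiEps]
  rw [Real.norm_eq_abs, Real.norm_eq_abs, abs_of_nonneg (by positivity),
    abs_of_nonneg (by positivity)] at hl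
  rw [le_div_iff₀ (by positivity), hD4]
  calc K₁ * (x ^ ((3 / 4 - 5 * fiEps) / 4 : ℝ) * Real.log x ^ (2 ^ 23 : ℕ)) *
        x ^ (9 / 16 + fiEps : ℝ) * L ^ 2
      = K₁ * (x ^ ((3 / 4 - 5 * fiEps) / 4 : ℝ) * x ^ (9 / 16 + fiEps : ℝ)) *
          (Real.log x ^ (2 ^ 23 : ℕ) * L ^ 2) := by ring
    _ = K₁ * x ^ (3 / 4 - 1 / 800 : ℝ) * Real.log x ^ (5 * 2 ^ 23 : ℕ) := by rw [hexp, hpow]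
    _ ≤ K₁ * x ^ (3 / 4 - 1 / 800 : ℝ) * (2 * friedlanderIwaniecKappa / K₁ * x ^ (1 / 800 : ℝ)) := by
        gcongr
    _ = 2 * friedlanderIwaniecKappa * (x ^ (3 / 4 - 1 / 800 : ℝ) * x ^ (1 / 800 : ℝ)) := by
        field_simp
    _ = 2 * friedlanderIwaniecKappa * x ^ (3 / 4 : ℝ) := by rw [← Real.rpow_add hx0]; norm_num
    _ ≤ fiCount x := hAx.1

/-- (2.11) from Proposition 4.1 (with `η = 1/16`, `A = 2^26 + 5`), for `δ = (log x)^B`. [folklore] -/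
theorem hyp211_of_prop41 (h41 : FriedlanderIwaniec1998_prop41) :
    ∃ B : ℝ, 0 < B ∧ ∀ᶠ x : ℝ in atTop, ∀ C : ℝ, 1 ≤ C → C ≤ x / fiLevel x →
      ∀ N : ℝ, Real.sqrt (fiLevel x) / x ^ fiEps < N → N < Real.sqrt x / Real.log x ^ B →
        fiSieveSeq.fiBilinearPi x N C (fiP x) ≤ fiSieveSeq.size x / Real.log x ^ (2 ^ 26 : ℕ) := by
  obtain ⟨B, hB, K, hev⟩ := h41 (1 / 16) (by norm_num) (2 ^ 26 + 5) (by norm_num)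
  refine ⟨B, hB, ?_⟩
  have hll : Tendsto (fun x : ℝ => Real.log (Real.log x)) atTop atTop :=
    Real.tendsto_log_atTop.comp Real.tendsto_log_atTop
  have h44 : ∀ᶠ x : ℝ in atTop, ‖Real.log (Real.log x) ^ 4‖ ≤ 1 * ‖Real.log x‖ :=
    ((Real.isLittleO_pow_log_id_atTop (n := 4)).comp_tendsto Real.tendsto_log_atTop).def one_pos
  filter_upwards [hev, eventually_gt_atTop 1, h44, hll.eventually_ge_atTop 1,
    Real.tendsto_log_atTop.eventually_ge_atTop (max K 1)] with x hx hx1 h3 h4 h5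
  intro C hC1 hC2 N hN1 hN2
  have hx0 : 0 < x := zero_lt_one.trans hx1
  have hlog0 : 0 < Real.log x := Real.log_pos hx1
  have hll0 : 0 < Real.log (Real.log x) := zero_lt_one.trans_le h4
  -- the range (4.4) for `P = exp((log log x)²)`
  have hP1 : Real.log (Real.log x) ^ 2 ≤ Real.log (fiP x) := by rw [fiP, Real.log_exp]
  have hP2 : Real.log (fiP x) ≤ Real.log x * (Real.log (Real.log x))⁻¹ ^ 2 := by
    rw [fiP, Real.log_exp, Real.norm_eq_abs, Real.norm_eq_abs, abs_of_nonneg (by positivity),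
      abs_of_pos hlog0, one_mul] at *
    rw [inv_pow, ← div_eq_mul_inv, le_div_iff₀ (by positivity)]
    calc Real.log (Real.log x) ^ 2 * Real.log (Real.log x) ^ 2 = Real.log (Real.log x) ^ 4 := by ring
      _ ≤ Real.log x := h3
  -- the range (4.6) for `N`
  have hlow : Real.sqrt (fiLevel x) / x ^ fiEps = x ^ ((3 / 4 - 5 * fiEps) / 2 - fiEps : ℝ) := by
    rw [fiLevel, Real.sqrt_eq_rpow, ← Real.rpow_mul hx0.le, ← Real.rpow_sub hx0]
    congr 1; ring
  rw [hlow] at hN1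
  have hN0 : 0 < N := (Real.rpow_pos_of_pos hx0 _).trans hN1
  have hN1' : x ^ (1 / 4 + 1 / 16 : ℝ) < N :=
    (Real.rpow_le_rpow_of_exponent_le hx1.le (by norm_num [fiEps])).trans_lt hN1
  have hN2' : N < x ^ (1 / 2 : ℝ) / Real.log x ^ B := by rwa [Real.sqrt_eq_rpow] at hN2
  -- the range `1 ≤ C ≤ N^{1 - η}`
  have hC2' : C ≤ N ^ (1 - 1 / 16 : ℝ) := by
    refine hC2.trans ?_
    have hxD : x / fiLevel x = x ^ (1 / 4 + 5 * fiEps : ℝ) := by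
      rw [fiLevel, div_eq_iff (Real.rpow_pos_of_pos hx0 _).ne', ← Real.rpow_add hx0]
      conv_lhs => rw [← Real.rpow_one x]
      congr 1; ring
    rw [hxD]
    calc x ^ (1 / 4 + 5 * fiEps : ℝ)
        ≤ x ^ (((3 / 4 - 5 * fiEps) / 2 - fiEps) * (1 - 1 / 16) : ℝ) :=
          Real.rpow_le_rpow_of_exponent_le hx1.le (by norm_num [fiEps])
      _ = (x ^ ((3 / 4 - 5 * fiEps) / 2 - fiEps : ℝ)) ^ (1 - 1 / 16 : ℝ) := Real.rpow_mul hx0.le _ _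
      _ ≤ N ^ (1 - 1 / 16 : ℝ) := Real.rpow_le_rpow (by positivity) hN1.le (by norm_num)
  refine (hx (fiP x) hP1 hP2 N hN1' hN2' C hC1 hC2').trans ?_
  -- `K A(x) (log x)^{4 - A} ≤ A(x) (log x)^{-2^26}` once `log x ≥ K`
  have hA0 : 0 ≤ fiCount x := Finset.sum_nonneg fun _ _ => Nat.cast_nonneg _
  have hpow : Real.log x ^ (4 - (2 ^ 26 + 5) : ℝ) = (Real.log x ^ (2 ^ 26 : ℕ))⁻¹ * (Real.log x)⁻¹ := by
    rw [show (4 - (2 ^ 26 + 5) : ℝ) = -((2 ^ 26 + 1 : ℕ) : ℝ) by push_cast; ring,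
      Real.rpow_neg hlog0.le, Real.rpow_natCast, pow_succ, mul_inv]
  change K * fiCount x * Real.log x ^ (4 - (2 ^ 26 + 5) : ℝ) ≤ fiCount x / Real.log x ^ (2 ^ 26 : ℕ)
  rw [hpow, div_eq_mul_inv]
  have hK : K ≤ Real.log x := (le_max_left K 1).trans h5
  have hKl : K * (Real.log x)⁻¹ ≤ 1 := by
    rw [← div_eq_mul_inv, div_le_one hlog0]; exact hK
  calc K * fiCount x * ((Real.log x ^ (2 ^ 26 : ℕ))⁻¹ * (Real.log x)⁻¹)
      = (K * (Real.log x)⁻¹) * (fiCount x * (Real.log x ^ (2 ^ 26 : ℕ))⁻¹) := by ring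
    _ ≤ 1 * (fiCount x * (Real.log x ^ (2 ^ 26 : ℕ))⁻¹) :=
        mul_le_mul_of_nonneg_right hKl (by positivity)
    _ = fiCount x * (Real.log x ^ (2 ^ 26 : ℕ))⁻¹ := one_mul _

/-- **(4.7) with (4.8) from the sieve-theoretic inputs** ((4.2) as a hypothesis).
[cite: FriedlanderIwaniecAnnals1998, §4, deduction of (4.7) from Propositions 2.1, 3.5, 4.1] -/
theorem primeSum_asymp_of_inputs (h21 : FriedlanderIwaniec1998_prop21)
    (h35 : FriedlanderIwaniec1998_prop35) (h41 : FriedlanderIwaniec1998_prop41)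
    (h48 : FriedlanderIwaniec1998_densityConstant) (h22 : FriedlanderIwaniec1998_hyp22)
    (h27 : FriedlanderIwaniec1998_hyp27) (h28 : FriedlanderIwaniec1998_hyp28)
    (h42 : FriedlanderIwaniec1998_count_asymp) : FriedlanderIwaniec1998_primeSum_asymp := by
  obtain ⟨B, hB, h211⟩ := hyp211_of_prop41 h41
  have hhyp : fiSieveSeq.FI1998SieveHypotheses fiLevel (fun x => Real.log x ^ B)
      (fun x => x ^ fiEps) fiP := by
    refine ⟨fiSieveSeq_size_eq, hyp21_of_count h42, ?_, fun p hp => fiDensity_hyp24 hp, ?_, h27, ?_,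
      ranges_eventually hB, hyp29_of_prop35 h35 h42, h211⟩
    · -- (2.2)
      obtain ⟨c, hc, h⟩ := h22
      exact ⟨c, hc, h⟩
    · -- (2.5)-(2.6)
      refine ⟨3, fun p hp => ?_⟩
      obtain ⟨h1, h2⟩ := fiDensity_hyp2526 hp
      refine ⟨h1.trans ?_, h2⟩
      have : (0 : ℝ) < p := by exact_mod_cast hp.pos
      gcongr; norm_num
    · -- (2.8)
      obtain ⟨K, h⟩ := h28
      exact ⟨K, h⟩
  have hθ : fiEps < 1 / 3 := by norm_num [fiEps]
  have h := h21 fiSieveSeq fiLevel fiP B fiEps (4 / Real.pi) hB (by norm_num [fiEps]) hθ hhyp h48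
  exact h

end FriedlanderIwaniecPrimes
/-- **(4.7) with (4.8) from the printed architecture**: Proposition 2.1 + Proposition 3.5 +
Proposition 4.1 + (4.8) + the §3 hypotheses (2.2), (2.7), (2.8) give
`Literature.NumberTheory.Sieve.FriedlanderIwaniec1998_primeSum_asymp` ((4.2), needed for (2.1) and (2.9), is the proved
`FriedlanderIwaniec1998_count_asymp_holds`).
[cite: FriedlanderIwaniecAnnals1998, §4, deduction of (4.7) from Propositions 2.1, 3.5, 4.1] -/
theorem FriedlanderIwaniec1998_primeSum_asymp_of_inputs (h21 : FriedlanderIwaniec1998_prop21)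
    (h35 : FriedlanderIwaniec1998_prop35) (h41 : FriedlanderIwaniec1998_prop41)
    (h48 : FriedlanderIwaniec1998_densityConstant) (h22 : FriedlanderIwaniec1998_hyp22)
    (h27 : FriedlanderIwaniec1998_hyp27) (h28 : FriedlanderIwaniec1998_hyp28) :
    FriedlanderIwaniec1998_primeSum_asymp :=
  FriedlanderIwaniecPrimes.primeSum_asymp_of_inputs h21 h35 h41 h48 h22 h27 h28
    FriedlanderIwaniec1998_count_asymp_holds

/-- **Friedlander–Iwaniec, Theorem 1 (parity.S17) from the printed architecture**: the named fact
`Literature.NumberTheory.Sieve.friedlanderIwaniecSum_isEquivalent` follows from the seven named facts of this file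
(Prop. 2.1, Prop. 3.5, Prop. 4.1, (4.8), (2.2), (2.7), (2.8)); everything else in the printed proof
of Theorem 1 ((4.2), the deduction of (4.7), the deduction of (1.1)) is proved in
`FriedlanderIwaniecPrimes` and here.
[cite: FriedlanderIwaniecAnnals1998, Theorem 1 via §4] -/
theorem friedlanderIwaniecSum_isEquivalent_of_inputs (h21 : FriedlanderIwaniec1998_prop21)
    (h35 : FriedlanderIwaniec1998_prop35) (h41 : FriedlanderIwaniec1998_prop41)
    (h48 : FriedlanderIwaniec1998_densityConstant) (h22 : FriedlanderIwaniec1998_hyp22)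
    (h27 : FriedlanderIwaniec1998_hyp27) (h28 : FriedlanderIwaniec1998_hyp28) :
    friedlanderIwaniecSum_isEquivalent :=
  friedlanderIwaniecSum_isEquivalent_of_primeSum
    (FriedlanderIwaniec1998_primeSum_asymp_of_inputs h21 h35 h41 h48 h22 h27 h28)

end Literature.NumberTheory.Sieve
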